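import Mathlib.Analysis.SpecialFunctions.Trigonometric.Bounds
import Mathlib.Data.Finset.Sort
import Mathlib.Data.Set.Card
import Literature.MathematicalPhysics.StatisticalMechanics.Theil2006EnergyBounds
import Literature.MathematicalPhysics.StatisticalMechanics.Theil2006Proofs
import Literature.MathematicalPhysics.StatisticalMechanics.Theil2006SimplexExpansion
import HarnessLib

/-!
# Theil 2006, §2.3 and Appendix §4.2: discrete imbeddings (Definition 2.4), Remark 2.5, the
equilateral simplices `𝒯_λ(y)` (Definition 2.6), Lemma 4.7 (off `𝒩(∂X)` the neighbourhood of a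
particle is a hexagonal wheel carrying a unique local discrete imbedding), discrete paths, the
rotations `Q_γ(k)` of (59) and the Burgers vector (Definition 4.4, Remark 4.5) — definitions with
the printed API; Remark 2.5, Lemma 4.7 and the well-definedness of `Q_γ(k)` proved

Topic `Literature/MathematicalPhysics/StatisticalMechanics`; companion of `Theil2006.lean`
(F. Theil, *A proof of crystallization in two dimensions*, Comm. Math. Phys. **262** (2006)
209–236; read in the author's accepted preprint of 26 Aug 2005, numbering identical, lit store
`paper:url-69bff4ce1e30`, pp. 7–9 and Appendix pp. 19–24), of `Theil2006DistanceSet.lean`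
(`Λ` = `Theil2006.distSet`, (21)–(22)), of `Theil2006LongRange.lean` ((31), (33), which take a
`T ∈ 𝒯_λ(y)` through the conclusion (25) of Lemma 2.7 only) and of `Theil2006Proofs.lean`
(Proposition 2.3: the law of cosines `norm_sub_sq_eq_cos_arg` behind "at most six neighbours").
This file supplies the VOCABULARY of §2.3 and of the Appendix §4.2 on which Lemma 2.7,
Propositions 2.8/2.9, the splitting (29), Lemma 4.6 and Proposition 4.8 are phrased, as real
definitions with bodies, proves Remark 2.5, proves Lemma 4.7 (printed without proof) with the
explicit threshold `α₀ = 1/200`, and proves that the rotations `Q_γ(k)` of (59) are well defined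
(Remark 4.5).  No named fact is introduced or discharged (D-0026); nothing here is a restatement
of a tree fact.

## Source, verbatim (preprint p. 7–8; `𝒮(y)`, `𝒩(x)`, `∂X(y)` as on p. 4, `B(η,r)` = the CLOSED
ball, p. 4)

* **Definition 2.4** (Discrete imbeddings). "Let `y : X → ℝ²` satisfy (13), `ω ⊂ X ∖ ∂X(y)` and
  `Φ : ω → A₂` be a discrete map. `Φ` is called `y`-continuous if
  (19) `|Φ(x) − Φ(x')| ≤ 1` for all `{x,x'} ∈ 𝒮(y)` such that `{x,x'} ⊂ ω`.
  A discrete `y`-continuous map `Φ` is called orientation preserving with respect to the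
  configuration `y` if
  (20) `det(y(x₂) − y(x₁), y(x₃) − y(x₁)) · det(Φ(x₂) − Φ(x₁), Φ(x₃) − Φ(x₁)) ≥ 0`
  holds for all `{x₁,x₂,x₃} ⊂ ω` such that `{x₁,x₂}, {x₁,x₃}, {x₂,x₃} ∈ 𝒮(y)`.
  A `y`-continuous map `Φ` which is also injective is called discrete imbedding.
  Throughout the paper “discrete imbedding” means ”discrete orientation preserving imbedding”."
* **Remark 2.5.** "In fact discrete imbeddings satisfy the stronger relation
  `|Φ(x) − Φ(x')| = 1` if and only if `{x,x'} ∈ 𝒮(y)`, provided that `{x,x'} ⊂ ω`. This follows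
  from the definition and the obvious fact that for each `η ∈ A₂` we have that
  `#{η' ∈ A₂ | |η − η'| ∈ (0,1]} = 6`."
* (p. 8) "The countable set `Λ = {λ > 0 | m(λ) ≠ 0}` is the set of distances."
  (`Theil2006.distSet`, `Theil2006DistanceSet.lean`.)
* **Definition 2.6** (Equilateral simplices). "Let `T ⊂ X` such that `#T = 3` and `λ ∈ Λ`. We say
  that `T` is an equilateral simplex with side length `λ` for the configuration `y` satisfying (13)
  and write shortly `T ∈ 𝒯_λ(y)` if either
  `λ = 1` and `p ∈ 𝒮` for all `p ⊂ T` such that `p ∈ 𝒫`,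
  or
  if `λ > 1`, `B(z, 20λ) ∩ y(∂X) = ∅` and there exists a patch `ω_T ⊂ X ∖ ∂X` with `T ⊂ ω_T` and
  a discrete imbedding `Φ_T : ω_T → 𝒜 ⊂ A₂` with the properties
  (23) `|Φ(x) − Φ(x')| = λ` for all `{x,x'} ⊂ T`,
  (24) `B(z, 5λ) ∩ A₂ ⊃ y(ω_T) ⊃ B(z, 3λ) ∩ A₂`,
  where `z = ⅓ Σ_{x ∈ T} y(x)`."
* **Proposition 2.8** (p. 8), the set it is about: "`𝒯(x₁,x₂) = {T ∈ ∪_{λ ∈ Λ∖{1}} 𝒯_λ(y) |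
  {x₁,x₂} ⊂ T}`".
* **Lemma 4.7** (Appendix §4.2, p. 20; printed WITHOUT proof: "We require a lemma which provides
  elementary geometric assertions. Since there is no multi-scale aspect present in the proof it is
  omitted.").  "There exists `α₀ > 0` such that for all `α ∈ (0, α₀)` the following assertion is
  true. Let `x ∈ X ∖ 𝒩(∂X)` and `x' ∈ 𝒩(x) ∖ {x}`. For each pair `ξ, ξ' ∈ A₂` such that
  `|ξ − ξ'| = 1` there exists a unique discrete imbedding `φ : 𝒩(x) → A₂` such that `φ(x) = ξ`
  and `φ(x') = ξ'`. In particular, `conv(y(𝒩(x))) ∩ y(X) = y(𝒩(x))`."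
  Standing hypothesis of §2.3–§4 (p. 4: "The other arguments are only based on the bound (13)"):
  (13) `min_{x ≠ x'} |y(x) − y(x')| > 1 − α`; `𝒩(∂X) = ⋃_{x'' ∈ ∂X} 𝒩(x'')` (p. 4), so
  `x ∈ X ∖ 𝒩(∂X)` says: `x` is not a defect and no `𝒮`-neighbour of `x` is a defect.
* **Definition 4.4** (discrete paths; p. 19), **(59)** (the rotations `Q_γ(k) ∈ SO(2)`), the
  **Burgers vector** `b(γ, v) = Σ_{k=0}^{K−1} Π_{i=0}^{k} Q_γ(i) v` and **Remark 4.5** (p. 20) are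
  quoted in full in the section `Paths` below.

## Rendering and the two print issues this file settles

* `A₂ = triPoint(ℤ²)` (`Theil2006.lean`); a "discrete map `Φ : ω → A₂`" is rendered in lattice
  coordinates as `Φ : X → ℤ × ℤ` together with the patch `ω : Set X` on which its properties are
  required (values off `ω` are irrelevant), and `|Φ(x) − Φ(x')|` is
  `dist (triPoint (Φ x)) (triPoint (Φ x'))`.  The index set `X` is an arbitrary type (the paper uses
  `X = X_N` finite in §2 and `X ⊂ A₂` infinite, periodic, in §3); for `X = Fin N` the relation
  `Theil2006.IsShortRange` and the sets `Theil2006.nbhdSet`, `Theil2006.defectSet` below are the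
  coercions of the tree's `shortRangePairs` / `nbhd` / `defects` of `Theil2006.lean`
  (`mem_shortRangePairs_iff`, `coe_nbhd`, `coe_defects`).  `det` is `Theil2006.det₂`
  (`Theil2006SimplexExpansion.lean`).  The standing hypotheses of Definition 2.4 ("`y` satisfies
  (13)", "`ω ⊂ X ∖ ∂X(y)`") are hypotheses on `y` and `ω`, not properties of `Φ`; they are kept as
  explicit hypotheses of the lemmas that need them and as explicit clauses of Definition 2.6, not
  bundled into `IsDiscreteImbeddingOn`.
* **Remark 2.5 needs a proviso, and is proved with it.**  The direction "`{x,x'} ∈ 𝒮(y)` ⇒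
  `|Φ(x) − Φ(x')| = 1`" holds exactly as printed (`IsDiscreteImbeddingOn.dist_eq_one`: `≤ 1` by
  (19), `≠ 0` by injectivity, and non-zero lattice vectors have length `≥ 1`).  The direction
  "`|Φ(x) − Φ(x')| = 1` ⇒ `{x,x'} ∈ 𝒮(y)`" is FALSE under the printed proviso `{x,x'} ⊂ ω` alone
  (take `ω = {x,x'}` not an `𝒮`-pair, `Φ(x) = 0`, `Φ(x') = b₁`: (19), (20) and injectivity hold
  vacuously); the paper's one-line argument ("`#{η' : |η − η'| ∈ (0,1]} = 6`": the six
  `𝒮`-neighbours of the non-defect `x` are mapped injectively onto the six lattice neighbours of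
  `Φ(x)`, so no seventh point of `ω` can land there) uses that the whole neighbourhood `𝒩(x)` lies
  in `ω`.  We prove it under that proviso (`IsDiscreteImbeddingOn.isShortRange_of_dist_eq_one`,
  `…dist_eq_one_iff`, via `…image_neighbours_eq`), which is how the Remark is used in the paper
  (patches `ω_T`, `y⁻¹(Ω')` of Lemma 4.7 / Proposition 4.8, away from their rims), and we prove the
  quoted lattice count (`ncard_lattice_puncturedUnitBall`, `ncard_triangularLattice_puncturedUnitBall`).
* **(24) is type-confused as printed and is rendered in reading (a).**  `y(ω_T) ⊂ ℝ²` is a set of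
  particle POSITIONS while `B(z,kλ) ∩ A₂` are LATTICE points; for a deformed configuration
  `y(ω_T) ∩ A₂` is typically empty, so the printed sandwich cannot be meant literally.  The
  Appendix fixes the intended reading: in the proof of Lemma 2.7 (p. 23) "`Ω' = B(η, 3λ)`.
  Proposition 4.8 implies that there exists a discrete imbedding `Φ : y⁻¹(Ω') → A₂` which
  (1) coincides with `Φ_T` up to rotation and translation" — so `Φ_T` must be defined on
  `y⁻¹(B(z,3λ))`, i.e. `y(ω_T) ⊃ B(z,3λ) ∩ y(X)`; and in the proof of Proposition 2.8 (2) (p. 24)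
  the witness patch is "`ω_± = y⁻¹(Ω)`", a `y`-PREIMAGE of a ball, and "(61) implies that
  `|⅓ Σ_{x∈T_±} y(x) − y(x₁)| ≤ λ`, hence the inclusion (24) is satisfied" — a verification in
  `y`-space.  Hence (24) is rendered as
  `B(z, 5λ) ∩ y(X) ⊃ y(ω_T) ⊃ B(z, 3λ) ∩ y(X)` (closed balls), i.e. the patch consists of particles
  within `5λ` of the barycentre `z` and contains every particle within `3λ` of it
  (the last two clauses of `IsEquilateralSimplex`; pointwise / preimage forms, the latter under the
  injectivity of `y` that (13) provides: `dist_le_of_image_subset`, `mem_patch_of_dist_le`).  The alternative reading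
  (b) "`Φ_T(ω_T)` sandwiched between lattice balls" differs from (a) only in constants under the
  rigidity estimate (61) and is NOT what pp. 23–24 use.  `-- TODO(reading b)`: none needed downstream.
* "`Φ_T : ω_T → 𝒜 ⊂ A₂`": the sub-lattice `𝒜` plays no role beyond (23) (the three image points are
  pairwise at lattice distance `λ`), and is not a datum of the definition; `λ ∈ Λ` is then
  AUTOMATIC (`IsEquilateralSimplex.exists_norm_triPoint_eq`: `λ` is the length of a non-zero lattice
  vector, `= λ ∈ Λ` by `Theil2006.mem_distSet_iff`), so
  `𝒯_λ(y)` is defined for every real `λ` and is empty off `Λ`.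
* p. 7 also defines sub-lattices, the lattice parameter and `D₆`-invariance, used only to define
  `m(λ)`; the tree defines `m(λ)` by the paper's formula (21) (`Theil2006.m`, with the printed
  examples `m(1) = 1`, `m(√7) = 2` proved there), so these three notions are not vendored here.

## Contents (namespace `Literature.MathematicalPhysics.StatisticalMechanics.Theil2006`)

* `IsShortRange α y x x'` — `{x,x'} ∈ 𝒮(y)`: `||y(x) − y(x')| − 1| ≤ α` (symmetric; irreflexive for
  `α < 1`); `nbhdSet α y x` = `𝒩(x)`; `defectSet α y` = `∂X(y)`; bridges to `Theil2006.lean`'s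
  `Fin N` finsets; `ncard_neighbours_eq_six` (a non-defect has exactly six `𝒮`-neighbours).
* `IsYContinuousOn` (19), `IsOrientationPreservingOn` (20), `IsDiscreteImbeddingOn` (Def. 2.4);
  `IsDiscreteImbeddingOn.mono` (restriction to a sub-patch).
* Remark 2.5: `IsDiscreteImbeddingOn.dist_eq_one`, `.sub_mem_unitShell`, `.image_neighbours_eq`,
  `.isShortRange_of_dist_eq_one`, `.dist_eq_one_iff`; the lattice count
  `ncard_lattice_unitNeighbours` / `ncard_lattice_puncturedUnitBall` /
  `ncard_triangularLattice_puncturedUnitBall` (`= 6`).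
* `simplexCentre y T` (`z = ⅓ Σ_{x∈T} y(x)`), `IsEquilateralSimplex α y λ T` and
  `equilateralSimplices α y λ` = `𝒯_λ(y)` (Def. 2.6), `longSimplicesThrough α y x₁ x₂` = `𝒯(x₁,x₂)`
  (Prop. 2.8); API: `card_eq_three`, `isEquilateralSimplex_one_iff`, `one_le`,
  `exists_norm_triPoint_eq` (`λ ∈ Λ`),
  `sqrt_three_le`, `not_mem_defectSet`, `mem_patch_of_dist_le`.
* Non-vacuity on the perfect lattice `y = triPoint : ℤ² → A₂` (`0 ≤ α < √3 − 1`): `IsShortRange` iff the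
  labels differ by a unit vector, `defectSet = ∅`, the identity is a discrete imbedding on every
  patch, every lattice unit triangle lies in `𝒯₁`, and `{0, b₁ + b₂, 2b₂ − b₁} ∈ 𝒯_{√3}`
  (`triPoint_mem_equilateralSimplices_sqrt_three`).
* **Lemma 4.7 (Appendix, p. 20), combinatorial half** (last section; the paper prints the lemma
  WITHOUT proof): on a *hexagonal neighbourhood* `𝒩(x) = {x, p₀, …, p₅}` (`IsHexagonalNbhd`: the
  six `𝒮`-neighbours listed counter-clockwise, consecutive ones `𝒮`-pairs, the others not) the
  discrete imbeddings `φ : 𝒩(x) → A₂` with prescribed `φ(x) = ξ`, `φ(p₀) = ξ'` (`|ξ − ξ'| = 1`)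
  EXIST and are UNIQUE, namely the hexagon walk `φ(p_i) = ξ + R^i(ξ' − ξ)`, `R` = `rot60` the
  rotation of `A₂` by `π/3` (`IsHexagonalNbhd.exists_discreteImbedding`, `.apply_rim_eq`,
  `.eqOn_of_discreteImbedding`; lattice input `eq_rot60_or_eq_rot60_iterate_five`: two adjacent
  lattice points have exactly two common neighbours, cf. "(68) has at most two solutions", p. 23).
* **Lemma 4.7, geometric half and assembly** (section `Geometry`, `α₀ = 1/200`; the "elementary
  geometric considerations" the paper omits, in complex coordinates `ℝ² ≅ ℂ`):
  `exists_ccwNbhd` — under (13) with `0 < α ≤ 1/200` the six `𝒮`-neighbours of a non-defect `q`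
  can be listed counter-clockwise `p₀ = a, …, p₅` from any prescribed neighbour `a`, with
  normalised angles `0 = θ₀ < ⋯ < θ₅ < 2π − 1` at `y(q)` and consecutive angles more than `1`
  apart (two neighbours lie in the annulus `[1 − α, 1 + α]` at mutual distance `> 1 − α`, so the
  cosine of their angle is `< 53/100 < cos 1`; sort with `Finset.orderEmbOfFin`);
  `CcwNbhd.det₂_pos` (consecutive neighbours are positively oriented: `det = r r' sin g`,
  `g ∈ (1, 2π − 5) ⊂ (0, π)`), `CcwNbhd.not_isShortRange_of_not_adj` (non-adjacent neighbours
  are at angular distance `≥ 2`, so `|y(p_i) − y(p_j)|² ≥ 2(1 − α)² > (1 + α)²`),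
  `CcwNbhd.isShortRange_succ` (the apex argument: if `p_i` is not a defect, its own
  clockwise-next neighbour `w` after `q` satisfies `|y(w) − y(p_{i+1})| ≤ 3α + |g − π/3| + |h − π/3| < 1 − α`,
  so `w = p_{i+1}` by (13)); hence `exists_isHexagonalNbhd` (for `x ∈ X ∖ 𝒩(∂X)` the
  neighbourhood IS a hexagonal wheel, listed from any prescribed neighbour `x'`), and
  **Lemma 4.7 as printed**: `exists_discreteImbedding_nbhd` (existence),
  `eqOn_nbhd_of_discreteImbedding` (uniqueness, as agreement on `𝒩(x)`), and the rider
  `convexHull_image_nbhdSet_inter_range` (`conv(y(𝒩(x))) ∩ y(X) = y(𝒩(x))`: the hull lies in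
  the ball `B(y(x), 1 + α)`, whose particles other than `x` are by (13) `𝒮`-neighbours — true for
  every `x`).  Rendering: (13) is `∀ x ≠ x', 1 − α < dist (y x) (y x')` on the whole index type;
  `x ∈ X ∖ 𝒩(∂X)` is `x ∉ defectSet α y` together with `∀ x', IsShortRange α y x x' →
  x' ∉ defectSet α y`; "`|ξ − ξ'| = 1`" is `ξ' − ξ ∈ unitShell` (labels); `α₀ = 1/200` is ours
  ("we do not make any effort to optimize the constants", p. 4).
* **Definition 4.4, (59), the Burgers vector, Remark 4.5** (section `Paths`): `IsDiscretePath α y γ K`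
  (`γ : ℕ → X` read on `{0,…,K}`, consecutive `𝒮`-pairs), `IsClosedPath` (`γ K = γ 0`),
  `IsSimpleClosedPath` (injective on `{0,…,K−1}`); `turn α y γ k : Fin 6` — the rotation `Q_γ(k)`
  of (59) recorded by its exponent (`Q = R^j`, `R` = `rot60`: the rotations of `SO(2)` taking a
  unit vector of `A₂` to a unit vector of `A₂` are the six powers of the rotation by `π/3`),
  defined as printed through "an arbitrary discrete imbedding `φ` of `𝒩(γ(k))` with
  `φ(γ(k)) = 0`"; its well-definedness (Remark 4.5: "because of Lemma 4.7 the matrix `Q` is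
  independent of the choice of `φ`") is PROVED: `turn_spec` ((59) holds for every such `φ`),
  `turn_unique` ((59) for one `φ` pins the exponent), `turn_eq_add_three` (on a wheel listed from
  `p₀ = γ(k−1)` with `γ(k+1) = p_b` the exponent is `b + 3`), `apply_next_eq` ("`φ` can be
  reconstructed from (59)"); `burgersVector α y γ K v = Σ_{k<K} R^{t₁+⋯+t_k} v` (labels;
  "`Q_γ(0) = Id`"), `burgersVector_succ`; Remark 4.5 (Burgers half of the first sentence):
  `burgersVector_eq_zero_of_length_le_two`; sanity on the perfect lattice:
  `rot60_iterate_turn_triPoint` (`Q_γ(k)` turns step `k−1` onto step `k`),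
  `burgersVector_triPoint` (`b(γ, γ(1) − γ(0)) = γ(K) − γ(0)`), `burgersVector_triPoint_eq_zero`
  (closed lattice paths have `b = 0`).

What is NOT here: Lemma 2.7 (25), Propositions 2.8/2.9, the pair classes `𝒮_j`, `ℒ_j` of (29);
the domain `Ω(γ)` of a simple closed path, its positive orientation and `vol(Ω(γ))` (Definition
4.4 defines them through the Jordan curve theorem, which Mathlib does not have), hence the `vol`
parts of Remark 4.5 and Lemma 4.6; Proposition 4.8 (existence/uniqueness of reference
configurations on defect-free patches, via Burgers vectors and the rigidity Propositions 4.1/4.3,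
with Lemma 4.7 as the local input) — none proved in the tree yet.
-/

noncomputable section

open scoped BigOperators
open Set Metric

namespace Literature.MathematicalPhysics.StatisticalMechanics

namespace Theil2006

/-! ## Short-range pairs, neighbourhoods and defects for a configuration `y : X → ℝ²` -/

section ShortRange

variable {X : Type*} (α : ℝ) (y : X → Plane)

/-- The short-range relation `{x,x'} ∈ 𝒮(y)`: `||y(x) − y(x')| − 1| ≤ α` (p. 4:
`𝒮(y) := {{x,x'} ∈ 𝒫 | ||y(x) − y(x')| − 1| ≤ α}`); for `α < 1` it forces `x ≠ x'`
(`IsShortRange.ne`), so no separate "`#p = 2`" clause is needed. [cite: Theil2006, §2.1 (definition of 𝒮(y), preprint p. 4)] -/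
def IsShortRange (x x' : X) : Prop := |dist (y x) (y x') - 1| ≤ α

/-- The discrete neighbourhood `𝒩(x) := {x' ∈ X | {x,x'} ∈ 𝒮(y)} ∪ {x}`.
[cite: Theil2006, §2.1 (definition of 𝒩(x), preprint p. 4)] -/
def nbhdSet (x : X) : Set X := insert x {x' | IsShortRange α y x x'}

/-- The defects `∂X(y) := {x ∈ X | #𝒩(x) ≠ 7}` ("those particles whose neighborhood cannot be
mapped bijectively onto `A₂ ∩ B(0,1)`"); `#` is `Set.ncard` (an infinite neighbourhood —
excluded under (13) by (18) `#𝒩(x) ≤ 7` — has `ncard = 0 ≠ 7` and would count as a defect). [cite: Theil2006, §2.1 (definition of ∂X(y), preprint p. 4)] -/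
def defectSet : Set X := {x | (nbhdSet α y x).ncard ≠ 7}

variable {α y}

/-- `𝒮(y)` is a set of unordered pairs: the relation is symmetric. [cite: Theil2006, §2.1 (preprint p. 4)] -/
theorem IsShortRange.symm {x x' : X} (h : IsShortRange α y x x') : IsShortRange α y x' x := by
  unfold IsShortRange at h ⊢
  rwa [dist_comm]

/-- Symmetry of `𝒮(y)` as an `iff`. [cite: Theil2006, §2.1 (preprint p. 4)] -/
theorem isShortRange_comm {x x' : X} : IsShortRange α y x x' ↔ IsShortRange α y x' x :=
  ⟨IsShortRange.symm, IsShortRange.symm⟩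

/-- A short-range pair has length `≤ 1 + α`. [cite: Theil2006, §2.1 (preprint p. 4)] -/
theorem IsShortRange.dist_le {x x' : X} (h : IsShortRange α y x x') : dist (y x) (y x') ≤ 1 + α := by
  have := (abs_le.1 h).2
  linarith

/-- A short-range pair has length `≥ 1 − α`. [cite: Theil2006, §2.1 (preprint p. 4)] -/
theorem IsShortRange.le_dist {x x' : X} (h : IsShortRange α y x x') : 1 - α ≤ dist (y x) (y x') := by
  have := (abs_le.1 h).1
  linarith

/-- For `α < 1` a short-range pair consists of two different particles (`𝒮(y) ⊂ 𝒫`, the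
two-element subsets). [cite: Theil2006, §2.1 (preprint p. 4)] -/
theorem IsShortRange.ne (hα : α < 1) {x x' : X} (h : IsShortRange α y x x') : x ≠ x' := by
  rintro rfl
  have h' : (1 : ℝ) ≤ α := by
    unfold IsShortRange at h
    rwa [dist_self, zero_sub, abs_neg, abs_one] at h
  linarith

/-- No particle is its own neighbour (`α < 1`). [cite: Theil2006, §2.1 (preprint p. 4)] -/
theorem not_isShortRange_self (hα : α < 1) (x : X) : ¬ IsShortRange α y x x := fun h => h.ne hα rfl

/-- `x ∈ 𝒩(x)`. [cite: Theil2006, §2.1 (preprint p. 4)] -/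
theorem mem_nbhdSet_self (x : X) : x ∈ nbhdSet α y x := mem_insert _ _

/-- Membership in `𝒩(x)`. [cite: Theil2006, §2.1 (preprint p. 4)] -/
theorem mem_nbhdSet_iff {x x' : X} : x' ∈ nbhdSet α y x ↔ x' = x ∨ IsShortRange α y x x' := by
  simp [nbhdSet]

/-- Neighbours belong to the neighbourhood. [cite: Theil2006, §2.1 (preprint p. 4)] -/
theorem IsShortRange.mem_nbhdSet {x x' : X} (h : IsShortRange α y x x') : x' ∈ nbhdSet α y x :=
  mem_insert_of_mem _ h

/-- Membership in `∂X(y)`. [cite: Theil2006, §2.1 (preprint p. 4)] -/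
theorem mem_defectSet_iff {x : X} : x ∈ defectSet α y ↔ (nbhdSet α y x).ncard ≠ 7 := Iff.rfl

/-- **A non-defect has exactly six `𝒮`-neighbours** (`#𝒩(x) = 7` with `x` itself counted,
`α < 1`). [cite: Theil2006, §2.1 (definition of ∂X(y), preprint p. 4)] -/
theorem ncard_neighbours_eq_six (hα : α < 1) {x : X} (hx : x ∉ defectSet α y) :
    {x' | IsShortRange α y x x'}.ncard = 6 := by
  have h7 : (nbhdSet α y x).ncard = 7 := by
    by_contra h
    exact hx h
  have hfin : (nbhdSet α y x).Finite := Set.finite_of_ncard_ne_zero (by rw [h7]; norm_num)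
  have hxS : x ∉ {x' | IsShortRange α y x x'} := not_isShortRange_self hα x
  have h := Set.ncard_insert_of_notMem hxS (hfin.subset (subset_insert _ _))
  rw [show insert x {x' | IsShortRange α y x x'} = nbhdSet α y x from rfl, h7] at h
  omega

/-- The neighbour set of a non-defect is finite. [cite: Theil2006, §2.1 (preprint p. 4)] -/
theorem finite_neighbours (hα : α < 1) {x : X} (hx : x ∉ defectSet α y) :
    {x' | IsShortRange α y x x'}.Finite :=
  Set.finite_of_ncard_ne_zero (by rw [ncard_neighbours_eq_six hα hx]; norm_num)

/-! ### Bridges to the `Fin N` vocabulary of `Theil2006.lean` -/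

/-- The tree's ordered list `shortRangePairs α y` of `𝒮(y)` consists of the pairs `x < x'` with
`{x,x'} ∈ 𝒮(y)`. [cite: Theil2006, §2.1 (preprint p. 4)] -/
theorem mem_shortRangePairs_iff {N : ℕ} {y : Fin N → Plane} {p : Fin N × Fin N} :
    p ∈ shortRangePairs α y ↔ p.1 < p.2 ∧ IsShortRange α y p.1 p.2 := by
  simp [shortRangePairs, IsShortRange]

/-- The tree's finset `nbhd α y x` is `𝒩(x)`. [cite: Theil2006, §2.1 (preprint p. 4)] -/
theorem coe_nbhd {N : ℕ} (y : Fin N → Plane) (x : Fin N) :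
    (↑(nbhd α y x) : Set (Fin N)) = nbhdSet α y x := by
  ext x'
  simp [nbhd, nbhdSet, IsShortRange]

/-- The tree's finset `defects α y` is `∂X(y)`. [cite: Theil2006, §2.1 (preprint p. 4)] -/
theorem coe_defects {N : ℕ} (y : Fin N → Plane) :
    (↑(defects α y) : Set (Fin N)) = defectSet α y := by
  ext x
  simp only [defects, Finset.coe_filter, Finset.mem_univ, true_and, defectSet, mem_setOf_eq,
    ← coe_nbhd, Set.ncard_coe_finset]

end ShortRange

/-! ## The six lattice neighbours of a point of `A₂` (the count quoted in Remark 2.5) -/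

section Lattice

/-- A lattice vector of length `1` is one of the six unit vectors (the other non-zero vectors
have length `≥ √3`); = `norm_triPoint_eq_one_iff` of `Theil2006LatticeSymmetry.lean`, re-derived
from `Theil2006EnergyBounds.lean` to keep this file's imports minimal. [folklore] -/
private theorem mem_unitShell_of_norm_eq_one {k : ℤ × ℤ} (h : ‖triPoint k‖ = 1) :
    k ∈ unitShell := by
  by_contra hk
  by_cases hk0 : k = 0
  · subst hk0
    simp at h
  · have h3 := sqrt_three_le_norm_triPoint hk0 hk
    rw [h] at h3
    have h13 : (1 : ℝ) < √3 := by
      rw [show (1 : ℝ) = √1 by simp]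
      exact Real.sqrt_lt_sqrt (by norm_num) (by norm_num)
    linarith

/-- The lattice points at distance exactly `1` from `triPoint k` are `triPoint (k + ξ)`,
`ξ ∈ unitShell`. [cite: Theil2006, §2.3 Remark 2.5 (preprint p. 7)] -/
theorem lattice_unitNeighbours_eq (k : ℤ × ℤ) :
    {k' : ℤ × ℤ | dist (triPoint k) (triPoint k') = 1} = (fun ξ => k + ξ) '' ↑unitShell := by
  ext k'
  simp only [mem_setOf_eq, mem_image, Finset.mem_coe]
  rw [dist_comm, dist_triPoint]
  constructor
  · intro h
    exact ⟨k' - k, mem_unitShell_of_norm_eq_one h, by abel⟩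
  · rintro ⟨ξ, hξ, rfl⟩
    rw [add_sub_cancel_left]
    exact norm_triPoint_of_mem_unitShell hξ

/-- Every lattice point has exactly six lattice points at distance `1`.
[cite: Theil2006, §2.3 Remark 2.5 (preprint p. 7)] -/
theorem ncard_lattice_unitNeighbours (k : ℤ × ℤ) :
    {k' : ℤ × ℤ | dist (triPoint k) (triPoint k') = 1}.ncard = 6 := by
  rw [lattice_unitNeighbours_eq, Set.ncard_image_of_injective _ (add_right_injective k),
    Set.ncard_coe_finset, card_unitShell]

/-- The set of lattice points at distance `1` from a given one is finite. [folklore] -/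
private theorem finite_lattice_unitNeighbours (k : ℤ × ℤ) :
    {k' : ℤ × ℤ | dist (triPoint k) (triPoint k') = 1}.Finite := by
  rw [lattice_unitNeighbours_eq]
  exact (Finset.finite_toSet _).image _

/-- **"For each `η ∈ A₂` we have that `#{η' ∈ A₂ | |η − η'| ∈ (0,1]} = 6`"** (in labels: a
lattice distance in `(0,1]` equals `1`). [cite: Theil2006, §2.3 Remark 2.5 (preprint p. 7)] -/
theorem ncard_lattice_puncturedUnitBall (k : ℤ × ℤ) :
    {k' : ℤ × ℤ | 0 < dist (triPoint k) (triPoint k') ∧ dist (triPoint k) (triPoint k') ≤ 1}.ncard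
      = 6 := by
  have h : {k' : ℤ × ℤ | 0 < dist (triPoint k) (triPoint k') ∧ dist (triPoint k) (triPoint k') ≤ 1}
      = {k' : ℤ × ℤ | dist (triPoint k) (triPoint k') = 1} := by
    ext k'
    simp only [mem_setOf_eq]
    constructor
    · rintro ⟨h0, h1⟩
      refine le_antisymm h1 ?_
      rw [dist_triPoint] at h0 ⊢
      refine one_le_norm_triPoint fun hk => ?_
      rw [hk, map_zero, norm_zero] at h0
      exact lt_irrefl _ h0
    · intro h1
      exact ⟨by rw [h1]; exact one_pos, h1.le⟩
  rw [h, ncard_lattice_unitNeighbours]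

/-- The same count in `ℝ²`: for `η ∈ A₂`, `#{η' ∈ A₂ | |η − η'| ∈ (0,1]} = 6`.
[cite: Theil2006, §2.3 Remark 2.5 (preprint p. 7)] -/
theorem ncard_triangularLattice_puncturedUnitBall {η : Plane} (hη : η ∈ triangularLattice) :
    {η' ∈ triangularLattice | 0 < dist η η' ∧ dist η η' ≤ 1}.ncard = 6 := by
  obtain ⟨k, rfl⟩ := hη
  have h : {η' ∈ triangularLattice | 0 < dist (triPoint k) η' ∧ dist (triPoint k) η' ≤ 1} =
      triPoint '' {k' : ℤ × ℤ | 0 < dist (triPoint k) (triPoint k') ∧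
        dist (triPoint k) (triPoint k') ≤ 1} := by
    ext η'
    simp only [mem_setOf_eq, mem_image]
    constructor
    · rintro ⟨⟨k', rfl⟩, h⟩
      exact ⟨k', h, rfl⟩
    · rintro ⟨k', h, rfl⟩
      exact ⟨⟨k', rfl⟩, h⟩
  rw [h, Set.ncard_image_of_injective _ triPoint_injective, ncard_lattice_puncturedUnitBall]

end Lattice

/-! ## Definition 2.4: discrete imbeddings -/

section Imbedding

variable {X : Type*}

/-- **(19) `y`-continuity** of a discrete map `Φ : ω → A₂` (lattice coordinates):
`|Φ(x) − Φ(x')| ≤ 1` for all `{x,x'} ∈ 𝒮(y)` with `{x,x'} ⊂ ω`.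
[cite: Theil2006, §2.3 Definition 2.4 (19) (preprint p. 7)] -/
def IsYContinuousOn (α : ℝ) (y : X → Plane) (ω : Set X) (Φ : X → ℤ × ℤ) : Prop :=
  ∀ ⦃x⦄, x ∈ ω → ∀ ⦃x'⦄, x' ∈ ω → IsShortRange α y x x' →
    dist (triPoint (Φ x)) (triPoint (Φ x')) ≤ 1

/-- **(20) orientation preservation** with respect to `y`:
`det(y(x₂) − y(x₁), y(x₃) − y(x₁)) · det(Φ(x₂) − Φ(x₁), Φ(x₃) − Φ(x₁)) ≥ 0` for all
`{x₁,x₂,x₃} ⊂ ω` whose three pairs lie in `𝒮(y)` (`det` = `Theil2006.det₂`).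
[cite: Theil2006, §2.3 Definition 2.4 (20) (preprint p. 7)] -/
def IsOrientationPreservingOn (α : ℝ) (y : X → Plane) (ω : Set X) (Φ : X → ℤ × ℤ) : Prop :=
  ∀ ⦃x₁⦄, x₁ ∈ ω → ∀ ⦃x₂⦄, x₂ ∈ ω → ∀ ⦃x₃⦄, x₃ ∈ ω →
    IsShortRange α y x₁ x₂ → IsShortRange α y x₁ x₃ → IsShortRange α y x₂ x₃ →
      0 ≤ det₂ (y x₂ - y x₁) (y x₃ - y x₁) *
        det₂ (triPoint (Φ x₂) - triPoint (Φ x₁)) (triPoint (Φ x₃) - triPoint (Φ x₁))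

/-- **Definition 2.4 (discrete imbedding).** A discrete map `Φ : ω → A₂` (lattice coordinates,
`A₂ = triPoint(ℤ²)`) on a patch `ω ⊂ X` is a *discrete imbedding* for the configuration `y` if it
is `y`-continuous (19), orientation preserving (20) and injective on `ω` ("Throughout the paper
“discrete imbedding” means ”discrete orientation preserving imbedding”").  The paper's standing
hypotheses "`y` satisfies (13)" and "`ω ⊂ X ∖ ∂X(y)`" are hypotheses on `y`, `ω` and are stated
where used, not bundled here. [cite: Theil2006, §2.3 Definition 2.4 (preprint p. 7)] -/
structure IsDiscreteImbeddingOn (α : ℝ) (y : X → Plane) (ω : Set X) (Φ : X → ℤ × ℤ) :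
    Prop where
  /-- (19): `𝒮`-neighbours in `ω` go to lattice points at distance `≤ 1`. -/
  continuousOn : IsYContinuousOn α y ω Φ
  /-- (20): `𝒮`-triangles in `ω` keep their orientation. -/
  orientationOn : IsOrientationPreservingOn α y ω Φ
  /-- `Φ` is injective on `ω`. -/
  injOn : Set.InjOn Φ ω

variable {α : ℝ} {y : X → Plane} {ω : Set X} {Φ : X → ℤ × ℤ}

/-- (19) restricts to sub-patches. [cite: Theil2006, §2.3 Definition 2.4 (19) (preprint p. 7)] -/
theorem IsYContinuousOn.mono {ω' : Set X} (h : IsYContinuousOn α y ω Φ) (hω : ω' ⊆ ω) :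
    IsYContinuousOn α y ω' Φ :=
  fun _ hx _ hx' hs => h (hω hx) (hω hx') hs

/-- (20) restricts to sub-patches. [cite: Theil2006, §2.3 Definition 2.4 (20) (preprint p. 7)] -/
theorem IsOrientationPreservingOn.mono {ω' : Set X} (h : IsOrientationPreservingOn α y ω Φ)
    (hω : ω' ⊆ ω) : IsOrientationPreservingOn α y ω' Φ :=
  fun _ h₁ _ h₂ _ h₃ s₁₂ s₁₃ s₂₃ => h (hω h₁) (hω h₂) (hω h₃) s₁₂ s₁₃ s₂₃

/-- A discrete imbedding restricts to a discrete imbedding of any sub-patch.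
[cite: Theil2006, §2.3 Definition 2.4 (preprint p. 7)] -/
theorem IsDiscreteImbeddingOn.mono {ω' : Set X} (h : IsDiscreteImbeddingOn α y ω Φ) (hω : ω' ⊆ ω) :
    IsDiscreteImbeddingOn α y ω' Φ :=
  ⟨h.continuousOn.mono hω, h.orientationOn.mono hω, h.injOn.mono hω⟩

/-! ### Remark 2.5 -/

/-- **Remark 2.5, "⇒" (as printed).** A discrete imbedding maps every short-range pair
`{x,x'} ∈ 𝒮(y)`, `{x,x'} ⊂ ω`, to lattice points at distance EXACTLY `1`: `≤ 1` is (19), and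
`Φ(x) ≠ Φ(x')` (injectivity, `x ≠ x'` as `α < 1`) are distinct lattice points, at distance `≥ 1`.
[cite: Theil2006, §2.3 Remark 2.5 (preprint p. 7)] -/
theorem IsDiscreteImbeddingOn.dist_eq_one (hΦ : IsDiscreteImbeddingOn α y ω Φ) (hα : α < 1)
    {x x' : X} (hx : x ∈ ω) (hx' : x' ∈ ω) (h : IsShortRange α y x x') :
    dist (triPoint (Φ x)) (triPoint (Φ x')) = 1 := by
  refine le_antisymm (hΦ.continuousOn hx hx' h) ?_
  rw [dist_triPoint]
  refine one_le_norm_triPoint fun h0 => ?_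
  exact h.ne hα (hΦ.injOn hx hx' (sub_eq_zero.1 h0))

/-- Remark 2.5 "⇒" in labels: along a short-range pair a discrete imbedding steps by one of the
six unit vectors of `A₂`. [cite: Theil2006, §2.3 Remark 2.5 (preprint p. 7)] -/
theorem IsDiscreteImbeddingOn.sub_mem_unitShell (hΦ : IsDiscreteImbeddingOn α y ω Φ) (hα : α < 1)
    {x x' : X} (hx : x ∈ ω) (hx' : x' ∈ ω) (h : IsShortRange α y x x') :
    Φ x' - Φ x ∈ unitShell := by
  have h1 := hΦ.dist_eq_one hα hx hx' h
  rw [dist_comm, dist_triPoint] at h1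
  exact mem_unitShell_of_norm_eq_one h1

/-- **The mechanism of Remark 2.5.** If `x` is not a defect and its whole neighbourhood `𝒩(x)`
lies in the patch, a discrete imbedding maps the six `𝒮`-neighbours of `x` ONTO the six lattice
neighbours of `Φ(x)` (injectively into a six-element set, "`#{η' ∈ A₂ | |η − η'| ∈ (0,1]} = 6`").
[cite: Theil2006, §2.3 Remark 2.5 (preprint p. 7)] -/
theorem IsDiscreteImbeddingOn.image_neighbours_eq (hΦ : IsDiscreteImbeddingOn α y ω Φ)
    (hα : α < 1) {x : X} (hx : x ∉ defectSet α y) (hN : nbhdSet α y x ⊆ ω) :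
    Φ '' {x' | IsShortRange α y x x'} = {k' : ℤ × ℤ | dist (triPoint (Φ x)) (triPoint k') = 1} := by
  have hxω : x ∈ ω := hN (mem_nbhdSet_self x)
  have hsub : Φ '' {x' | IsShortRange α y x x'} ⊆
      {k' : ℤ × ℤ | dist (triPoint (Φ x)) (triPoint k') = 1} := by
    rintro _ ⟨x', hx', rfl⟩
    exact hΦ.dist_eq_one hα hxω (hN (IsShortRange.mem_nbhdSet hx')) hx'
  have hinj : Set.InjOn Φ {x' | IsShortRange α y x x'} :=
    hΦ.injOn.mono fun x' hx' => hN (IsShortRange.mem_nbhdSet hx')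
  refine Set.eq_of_subset_of_ncard_le hsub ?_ (finite_lattice_unitNeighbours _)
  rw [ncard_lattice_unitNeighbours, hinj.ncard_image, ncard_neighbours_eq_six hα hx]

/-- **Remark 2.5, "⇐" (with the proviso the paper's argument uses).** If `x ∉ ∂X(y)`,
`𝒩(x) ⊂ ω`, `x' ∈ ω` and `|Φ(x) − Φ(x')| = 1`, then `{x,x'} ∈ 𝒮(y)`: `Φ(x')` is one of the six
lattice neighbours of `Φ(x)`, all of which are images of `𝒮`-neighbours of `x`
(`image_neighbours_eq`), and `Φ` is injective on `ω`.  (Under the printed proviso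
`{x,x'} ⊂ ω` alone the statement fails, see the module docstring.)
[cite: Theil2006, §2.3 Remark 2.5 (preprint p. 7)] -/
theorem IsDiscreteImbeddingOn.isShortRange_of_dist_eq_one (hΦ : IsDiscreteImbeddingOn α y ω Φ)
    (hα : α < 1) {x x' : X} (hx : x ∉ defectSet α y) (hN : nbhdSet α y x ⊆ ω) (hx' : x' ∈ ω)
    (h1 : dist (triPoint (Φ x)) (triPoint (Φ x')) = 1) : IsShortRange α y x x' := by
  have hmem : Φ x' ∈ Φ '' {x'' | IsShortRange α y x x''} := by
    rw [hΦ.image_neighbours_eq hα hx hN]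
    exact h1
  obtain ⟨x'', hx'', hΦeq⟩ := hmem
  have h : x'' = x' := hΦ.injOn (hN (IsShortRange.mem_nbhdSet hx'')) hx' hΦeq
  rwa [← h]

/-- **Remark 2.5** as an `iff`: for a discrete imbedding `Φ` on `ω`, a non-defect `x` with
`𝒩(x) ⊂ ω` and any `x' ∈ ω`, `|Φ(x) − Φ(x')| = 1 ⟺ {x,x'} ∈ 𝒮(y)`.
[cite: Theil2006, §2.3 Remark 2.5 (preprint p. 7)] -/
theorem IsDiscreteImbeddingOn.dist_eq_one_iff (hΦ : IsDiscreteImbeddingOn α y ω Φ) (hα : α < 1)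
    {x x' : X} (hx : x ∉ defectSet α y) (hN : nbhdSet α y x ⊆ ω) (hx' : x' ∈ ω) :
    dist (triPoint (Φ x)) (triPoint (Φ x')) = 1 ↔ IsShortRange α y x x' :=
  ⟨hΦ.isShortRange_of_dist_eq_one hα hx hN hx',
    hΦ.dist_eq_one hα (hN (mem_nbhdSet_self x)) hx'⟩

end Imbedding

/-! ## Definition 2.6: equilateral simplices `𝒯_λ(y)` -/

section Simplices

variable {X : Type*} (α : ℝ) (y : X → Plane)

/-- The barycentre `z = ⅓ Σ_{x ∈ T} y(x)` of the image of a three-element `T ⊂ X`.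
[cite: Theil2006, §2.3 Definition 2.6 (preprint p. 8)] -/
def simplexCentre (T : Finset X) : Plane := (3 : ℝ)⁻¹ • ∑ x ∈ T, y x

/-- **Definition 2.6 (equilateral simplex with side length `λ`), `T ∈ 𝒯_λ(y)`.**  `#T = 3` and
EITHER `λ = 1` and every pair `p ⊂ T` lies in `𝒮(y)`, OR `λ > 1`, `B(z, 20λ) ∩ y(∂X) = ∅` (no
defect within `20λ` of the barycentre `z`, closed ball), and there are a patch `ω_T ⊂ X ∖ ∂X`
with `T ⊂ ω_T` and a discrete imbedding `Φ_T : ω_T → A₂` (Definition 2.4) with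
(23) `|Φ(x) − Φ(x')| = λ` for all `{x,x'} ⊂ T` and
(24) `B(z, 5λ) ∩ y(X) ⊃ y(ω_T) ⊃ B(z, 3λ) ∩ y(X)` — reading (a) of the printed
"`B(z,5λ) ∩ A₂ ⊃ y(ω_T) ⊃ B(z,3λ) ∩ A₂`", the one the Appendix uses (proof of Lemma 2.7, p. 23;
proof of Proposition 2.8 (2), p. 24; see the module docstring).  Defined for every real `λ`;
`λ ∈ Λ` follows (`IsEquilateralSimplex.exists_norm_triPoint_eq`). [cite: Theil2006, §2.3 Definition 2.6 (23) (24) (preprint p. 8)] -/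
def IsEquilateralSimplex (lam : ℝ) (T : Finset X) : Prop :=
  T.card = 3 ∧
    ((lam = 1 ∧ ∀ x ∈ T, ∀ x' ∈ T, x ≠ x' → IsShortRange α y x x') ∨
      (1 < lam ∧ (∀ x ∈ defectSet α y, 20 * lam < dist (y x) (simplexCentre y T)) ∧
        ∃ (ω : Set X) (Φ : X → ℤ × ℤ), Disjoint ω (defectSet α y) ∧ ↑T ⊆ ω ∧
          IsDiscreteImbeddingOn α y ω Φ ∧
          (∀ x ∈ T, ∀ x' ∈ T, x ≠ x' → dist (triPoint (Φ x)) (triPoint (Φ x')) = lam) ∧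
          y '' ω ⊆ closedBall (simplexCentre y T) (5 * lam) ∧
          closedBall (simplexCentre y T) (3 * lam) ∩ range y ⊆ y '' ω))

/-- **`𝒯_λ(y)`**, the set of equilateral simplices with side length `λ` of the configuration `y`.
[cite: Theil2006, §2.3 Definition 2.6 (preprint p. 8)] -/
def equilateralSimplices (lam : ℝ) : Set (Finset X) := {T | IsEquilateralSimplex α y lam T}

/-- **`𝒯(x₁,x₂) = {T ∈ ∪_{λ ∈ Λ∖{1}} 𝒯_λ(y) | {x₁,x₂} ⊂ T}`**, the long-range equilateral
simplices through a pair (Proposition 2.8; meant for `x₁ ≠ x₂`).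
[cite: Theil2006, §2.3 Proposition 2.8 (preprint p. 8)] -/
def longSimplicesThrough (x₁ x₂ : X) : Set (Finset X) :=
  {T | ∃ lam : ℝ, lam ≠ 1 ∧ IsEquilateralSimplex α y lam T ∧ x₁ ∈ T ∧ x₂ ∈ T}

variable {α y}

/-- Membership in `𝒯_λ(y)`. [cite: Theil2006, §2.3 Definition 2.6 (preprint p. 8)] -/
@[simp] theorem mem_equilateralSimplices_iff {lam : ℝ} {T : Finset X} :
    T ∈ equilateralSimplices α y lam ↔ IsEquilateralSimplex α y lam T := Iff.rfl

/-- Membership in `𝒯(x₁,x₂)`. [cite: Theil2006, §2.3 Proposition 2.8 (preprint p. 8)] -/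
theorem mem_longSimplicesThrough_iff {x₁ x₂ : X} {T : Finset X} :
    T ∈ longSimplicesThrough α y x₁ x₂ ↔
      ∃ lam : ℝ, lam ≠ 1 ∧ T ∈ equilateralSimplices α y lam ∧ x₁ ∈ T ∧ x₂ ∈ T := Iff.rfl

/-- An equilateral simplex has three vertices. [cite: Theil2006, §2.3 Definition 2.6 (preprint p. 8)] -/
theorem IsEquilateralSimplex.card_eq_three {lam : ℝ} {T : Finset X}
    (h : IsEquilateralSimplex α y lam T) : T.card = 3 := h.1

/-- **`𝒯₁(y)`**: the short-range simplices are exactly the three-element `T` all of whose pairs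
are short-range bonds. [cite: Theil2006, §2.3 Definition 2.6, case λ = 1 (preprint p. 8)] -/
theorem isEquilateralSimplex_one_iff {T : Finset X} :
    IsEquilateralSimplex α y 1 T ↔ T.card = 3 ∧ ∀ x ∈ T, ∀ x' ∈ T, x ≠ x' → IsShortRange α y x x' := by
  unfold IsEquilateralSimplex
  constructor
  · rintro ⟨h3, h | h⟩
    · exact ⟨h3, h.2⟩
    · exact absurd h.1 (lt_irrefl _)
  · rintro ⟨h3, h⟩
    exact ⟨h3, Or.inl ⟨rfl, h⟩⟩

/-- Side lengths are `≥ 1`. [cite: Theil2006, §2.3 Definition 2.6 (preprint p. 8)] -/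
theorem IsEquilateralSimplex.one_le {lam : ℝ} {T : Finset X} (h : IsEquilateralSimplex α y lam T) :
    1 ≤ lam := by
  rcases h.2 with h | h
  · exact h.1.symm.le
  · exact h.1.le

/-- In the long-range case the vertices are not defects (`T ⊂ ω_T ⊂ X ∖ ∂X`).
[cite: Theil2006, §2.3 Definition 2.6 (preprint p. 8)] -/
theorem IsEquilateralSimplex.not_mem_defectSet {lam : ℝ} {T : Finset X}
    (h : IsEquilateralSimplex α y lam T) (hlam : lam ≠ 1) {x : X} (hx : x ∈ T) :
    x ∉ defectSet α y := by
  rcases h.2 with h | ⟨-, -, ω, Φ, hdisj, hT, -⟩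
  · exact absurd h.1 hlam
  · exact fun hxd => hdisj.le_bot ⟨hT (Finset.mem_coe.2 hx), hxd⟩

/-- **`λ ∈ Λ` is automatic**: the side length of an equilateral simplex is a distance of `A₂`,
i.e. the length of a non-zero lattice vector — which is `λ ∈ Λ` by `Theil2006.mem_distSet_iff`
(`Theil2006DistanceSet.lean`): `λ = 1 = |b₁|`; for `λ > 1`, (23) and the injectivity of `Φ_T`
exhibit the vector. [cite: Theil2006, §2.3 Definition 2.6 with (21) (preprint p. 8)] -/
theorem IsEquilateralSimplex.exists_norm_triPoint_eq {lam : ℝ} {T : Finset X}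
    (h : IsEquilateralSimplex α y lam T) : ∃ k : ℤ × ℤ, k ≠ 0 ∧ ‖triPoint k‖ = lam := by
  rcases h.2 with hl | ⟨-, -, ω, Φ, -, hT, hΦ, h23, -⟩
  · refine ⟨(1, 0), by decide, ?_⟩
    rw [hl.1]
    exact norm_triPoint_of_mem_unitShell (by decide)
  · obtain ⟨x, hx, x', hx', hne⟩ : ∃ x ∈ T, ∃ x' ∈ T, x ≠ x' :=
      Finset.one_lt_card.1 (by rw [h.1]; norm_num)
    have hd := h23 x hx x' hx' hne
    rw [dist_triPoint] at hd
    refine ⟨Φ x - Φ x', fun h0 => hne ?_, hd⟩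
    exact hΦ.injOn (hT (Finset.mem_coe.2 hx)) (hT (Finset.mem_coe.2 hx')) (sub_eq_zero.1 h0)

/-- Long-range equilateral simplices have side length `≥ √3` (`Λ ∖ {1} ⊂ [√3, ∞)`: a lattice
vector of length `≠ 0, 1` lies outside the unit shell). [cite: Theil2006, §2.3 Definition 2.6 with (21) (preprint p. 8)] -/
theorem IsEquilateralSimplex.sqrt_three_le {lam : ℝ} {T : Finset X}
    (h : IsEquilateralSimplex α y lam T) (hlam : lam ≠ 1) : √3 ≤ lam := by
  obtain ⟨k, hk0, hk⟩ := h.exists_norm_triPoint_eq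
  rw [← hk]
  refine sqrt_three_le_norm_triPoint hk0 fun hmem => hlam ?_
  rw [← hk, norm_triPoint_of_mem_unitShell hmem]

/-- (24), lower inclusion, in preimage form: if `y` is injective (which (13) provides) and
`B(z, r) ∩ y(X) ⊂ y(ω)`, every particle within `r` of `z` belongs to the patch `ω`.
[cite: Theil2006, §2.3 Definition 2.6 (24) (preprint p. 8)] -/
theorem mem_patch_of_dist_le {ω : Set X} {z : Plane} {r : ℝ} (hy : Function.Injective y)
    (h : closedBall z r ∩ range y ⊆ y '' ω) {x : X} (hx : dist (y x) z ≤ r) : x ∈ ω := by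
  obtain ⟨x', hx', hxx'⟩ := h ⟨mem_closedBall.2 hx, mem_range_self x⟩
  rwa [← hy hxx']

/-- (24), upper inclusion, pointwise: every particle of the patch lies within `5λ` of the
barycentre. [cite: Theil2006, §2.3 Definition 2.6 (24) (preprint p. 8)] -/
theorem dist_le_of_image_subset {ω : Set X} {z : Plane} {r : ℝ}
    (h : y '' ω ⊆ closedBall z r) {x : X} (hx : x ∈ ω) : dist (y x) z ≤ r :=
  mem_closedBall.1 (h (mem_image_of_mem y hx))

end Simplices

/-! ## Non-vacuity: the perfect lattice `y = triPoint : ℤ² → A₂` -/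

section PerfectLattice

variable {α : ℝ}

/-- `√3 − 1 < 1`, so `α < √3 − 1` gives `α < 1`. [folklore] -/
private theorem sqrt_three_sub_one_lt_one : √3 - 1 < (1 : ℝ) := by
  have h : √3 < 2 := by
    rw [show (2 : ℝ) = √(2 ^ 2) by rw [Real.sqrt_sq]; norm_num]
    exact Real.sqrt_lt_sqrt (by norm_num) (by norm_num)
  linarith

/-- **On the perfect lattice the short-range pairs are the lattice bonds**: for
`0 ≤ α < √3 − 1`, `{k,k'} ∈ 𝒮(triPoint)` iff `k' − k` is one of the six unit vectors (lattice
distances are `0`, `1` or `≥ √3`). [cite: Theil2006, §2.3 Remark 2.5 (preprint p. 7)] -/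
theorem isShortRange_triPoint_iff (hα0 : 0 ≤ α) (hα : α < √3 - 1) {k k' : ℤ × ℤ} :
    IsShortRange α triPoint k k' ↔ k' - k ∈ unitShell := by
  unfold IsShortRange
  rw [dist_comm, dist_triPoint]
  constructor
  · intro h
    have hle : ‖triPoint (k' - k)‖ ≤ 1 + α := by
      have := (abs_le.1 h).2
      linarith
    by_contra hnot
    by_cases h0 : k' - k = 0
    · rw [h0, map_zero, norm_zero] at h
      norm_num at h
      linarith [sqrt_three_sub_one_lt_one]
    · have h3 := sqrt_three_le_norm_triPoint h0 hnot
      linarith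
  · intro h
    rw [norm_triPoint_of_mem_unitShell h]
    simpa using hα0

/-- On the perfect lattice `𝒩(k) = {k} ∪ (k + unitShell)` (`0 ≤ α < √3 − 1`).
[cite: Theil2006, §2.1 (definition of 𝒩(x), preprint p. 4)] -/
theorem nbhdSet_triPoint_eq (hα0 : 0 ≤ α) (hα : α < √3 - 1) (k : ℤ × ℤ) :
    nbhdSet α triPoint k = insert k ((fun ξ => k + ξ) '' ↑unitShell) := by
  ext k'
  rw [mem_nbhdSet_iff, mem_insert_iff, isShortRange_triPoint_iff hα0 hα]
  simp only [mem_image, Finset.mem_coe]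
  constructor
  · rintro (rfl | h)
    · exact Or.inl rfl
    · exact Or.inr ⟨k' - k, h, by abel⟩
  · rintro (rfl | ⟨ξ, hξ, rfl⟩)
    · exact Or.inl rfl
    · right
      rwa [add_sub_cancel_left]

/-- **The perfect lattice has no defects**: `#𝒩(k) = 7` for every `k` (`0 ≤ α < √3 − 1`).
[cite: Theil2006, §2.1 (definition of ∂X(y), preprint p. 4)] -/
theorem defectSet_triPoint_eq_empty (hα0 : 0 ≤ α) (hα : α < √3 - 1) :
    defectSet α (triPoint : ℤ × ℤ → Plane) = ∅ := by
  ext k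
  simp only [mem_defectSet_iff, mem_empty_iff_false, iff_false, not_not]
  rw [nbhdSet_triPoint_eq hα0 hα]
  have hk : k ∉ (fun ξ => k + ξ) '' (↑unitShell : Set (ℤ × ℤ)) := by
    rintro ⟨ξ, hξ, h⟩
    have : ξ = 0 := by simpa using h
    rw [this] at hξ
    exact absurd hξ (by decide)
  rw [Set.ncard_insert_of_notMem hk ((Finset.finite_toSet _).image _),
    Set.ncard_image_of_injective _ (add_right_injective k), Set.ncard_coe_finset, card_unitShell]

/-- **The identity is a discrete imbedding of the perfect lattice** on every patch
(`0 ≤ α < √3 − 1`): (19) holds with equality, (20) is a square, and `id` is injective.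
[cite: Theil2006, §2.3 Definition 2.4 (preprint p. 7)] -/
theorem isDiscreteImbeddingOn_id_triPoint (hα0 : 0 ≤ α) (hα : α < √3 - 1) (ω : Set (ℤ × ℤ)) :
    IsDiscreteImbeddingOn α triPoint ω id := by
  refine ⟨fun k _ k' _ hs => ?_, fun k₁ _ k₂ _ k₃ _ _ _ _ => ?_, Set.injOn_id ω⟩
  · rw [id, id, dist_comm, dist_triPoint,
      norm_triPoint_of_mem_unitShell ((isShortRange_triPoint_iff hα0 hα).1 hs)]
  · exact mul_self_nonneg _

/-- **Every lattice unit triangle is a short-range simplex of the perfect lattice**: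
`{k, k + b₁, k + b₂} ∈ 𝒯₁(triPoint)` (`0 ≤ α < √3 − 1`).
[cite: Theil2006, §2.3 Definition 2.6, case λ = 1 (preprint p. 8)] -/
theorem triPoint_unitTriangle_mem_equilateralSimplices_one (hα0 : 0 ≤ α) (hα : α < √3 - 1)
    (k : ℤ × ℤ) :
    ({k, k + (1, 0), k + (0, 1)} : Finset (ℤ × ℤ)) ∈ equilateralSimplices α triPoint 1 := by
  rw [mem_equilateralSimplices_iff, isEquilateralSimplex_one_iff]
  have h10 : k ≠ k + (1, 0) := fun h =>
    absurd (add_left_cancel (h.symm.trans (add_zero k).symm) : ((1, 0) : ℤ × ℤ) = 0) (by decide)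
  have h01 : k ≠ k + (0, 1) := fun h =>
    absurd (add_left_cancel (h.symm.trans (add_zero k).symm) : ((0, 1) : ℤ × ℤ) = 0) (by decide)
  have h11 : k + (1, 0) ≠ k + (0, 1) := fun h =>
    absurd (add_left_cancel h : ((1, 0) : ℤ × ℤ) = (0, 1)) (by decide)
  refine ⟨?_, ?_⟩
  · rw [Finset.card_insert_of_notMem (by simp [h10, h01]),
      Finset.card_insert_of_notMem (by simp [h11]), Finset.card_singleton]
  · intro x hx x' hx' hne
    rw [isShortRange_triPoint_iff hα0 hα]
    simp only [Finset.mem_insert, Finset.mem_singleton] at hx hx'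
    rcases hx with rfl | rfl | rfl <;> rcases hx' with rfl | rfl | rfl <;>
      first
      | exact absurd rfl hne
      | (ring_nf; decide)

/-- The vertices `0`, `b₁ + b₂`, `2b₂ − b₁` (labels `(0,0)`, `(1,1)`, `(-1,2)`) of an equilateral
lattice triangle of side `√3`; pairwise label differences have norm form `3`. [folklore] -/
private theorem norm_triPoint_eq_sqrt_three {d : ℤ × ℤ}
    (hd : d.1 ^ 2 + d.1 * d.2 + d.2 ^ 2 = 3) : ‖triPoint d‖ = √3 := by
  have h3 : ‖triPoint d‖ ^ 2 = 3 := by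
    rw [norm_triPoint_sq]
    exact_mod_cast hd
  rw [← Real.sqrt_sq (norm_nonneg (triPoint d)), h3]

/-- **A long-range equilateral simplex of the perfect lattice**:
`T = {0, b₁ + b₂, 2b₂ − b₁} ∈ 𝒯_{√3}(triPoint)` (`0 ≤ α < √3 − 1`), with barycentre `z = b₂`,
patch `ω_T = triPoint⁻¹(B(z, 5√3))` and `Φ_T = id`; shows that Definition 2.6 in reading (a) is
inhabited for `λ > 1`. [cite: Theil2006, §2.3 Definition 2.6 (preprint p. 8)] -/
theorem triPoint_mem_equilateralSimplices_sqrt_three (hα0 : 0 ≤ α) (hα : α < √3 - 1) :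
    ({(0, 0), (1, 1), (-1, 2)} : Finset (ℤ × ℤ)) ∈ equilateralSimplices α triPoint (√3) := by
  classical
  set T : Finset (ℤ × ℤ) := {(0, 0), (1, 1), (-1, 2)} with hT
  have h1lt : (1 : ℝ) < √3 := by
    rw [show (1 : ℝ) = √1 by simp]
    exact Real.sqrt_lt_sqrt (by norm_num) (by norm_num)
  have h3pos : (0 : ℝ) < √3 := one_pos.trans h1lt
  -- the barycentre is `b₂ = triPoint (0,1)`
  have hz : simplexCentre triPoint T = triPoint (0, 1) := by
    rw [simplexCentre, hT, Finset.sum_insert (by decide), Finset.sum_insert (by decide),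
      Finset.sum_singleton, ← map_add, ← map_add]
    rw [show ((0, 0) : ℤ × ℤ) + ((1, 1) + (-1, 2)) = (3 : ℤ) • (0, 1) by decide, map_zsmul]
    rw [show ((3 : ℤ) • triPoint (0, 1) : Plane) = (3 : ℝ) • triPoint (0, 1) by
      rw [← Int.cast_smul_eq_zsmul ℝ]; norm_num]
    rw [smul_smul]
    norm_num
  -- the vertices are at distance `1` from the barycentre
  have hvert : ∀ x ∈ T, dist (triPoint x) (triPoint (0, 1)) = 1 := by
    intro x hx
    rw [dist_triPoint]
    simp only [hT, Finset.mem_insert, Finset.mem_singleton] at hx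
    rcases hx with rfl | rfl | rfl <;> exact norm_triPoint_of_mem_unitShell (by decide)
  let ω : Set (ℤ × ℤ) := {k | dist (triPoint k) (triPoint (0, 1)) ≤ 5 * √3}
  refine ⟨?_, Or.inr ⟨h1lt, ?_, ω, id, ?_, ?_, isDiscreteImbeddingOn_id_triPoint hα0 hα ω,
    ?_, ?_, ?_⟩⟩
  · -- `#T = 3`
    rw [hT, Finset.card_insert_of_notMem (by decide), Finset.card_insert_of_notMem (by decide),
      Finset.card_singleton]
  · -- no defects at all
    intro x hx
    rw [defectSet_triPoint_eq_empty hα0 hα] at hx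
    exact absurd hx (Set.notMem_empty x)
  · -- the patch avoids the (empty) defect set
    rw [defectSet_triPoint_eq_empty hα0 hα]
    exact disjoint_bot_right
  · -- `T ⊂ ω_T`
    intro x hx
    show dist (triPoint x) (triPoint (0, 1)) ≤ 5 * √3
    rw [hvert x (Finset.mem_coe.1 hx)]
    linarith
  · -- (23): side length `√3`
    intro x hx x' hx' hne
    rw [id, id, dist_triPoint]
    simp only [hT, Finset.mem_insert, Finset.mem_singleton] at hx hx'
    rcases hx with rfl | rfl | rfl <;> rcases hx' with rfl | rfl | rfl <;>
      first
      | exact absurd rfl hne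
      | exact norm_triPoint_eq_sqrt_three (by decide)
  · -- (24), upper inclusion
    rintro _ ⟨k, hk, rfl⟩
    rw [hz]
    exact mem_closedBall.2 hk
  · -- (24), lower inclusion
    rintro _ ⟨hball, ⟨k, rfl⟩⟩
    rw [hz] at hball
    refine ⟨k, ?_, rfl⟩
    show dist (triPoint k) (triPoint (0, 1)) ≤ 5 * √3
    have := mem_closedBall.1 hball
    linarith

end PerfectLattice

/-! ## Lemma 4.7 (local discrete imbeddings), combinatorial half

Appendix, Lemma 4.7 (preprint p. 20), verbatim: "There exists `α₀ > 0` such that for all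
`α ∈ (0, α₀)` the following assertion is true. Let `x ∈ X ∖ 𝒩(∂X)` and `x' ∈ 𝒩(x) ∖ {x}`. For
each pair `ξ, ξ' ∈ A₂` such that `|ξ − ξ'| = 1` there exists a unique discrete imbedding
`φ : 𝒩(x) → A₂` such that `φ(x) = ξ` and `φ(x') = ξ'`. In particular,
`conv(y(𝒩(x))) ∩ y(X) = y(𝒩(x))`."  The paper prints NO proof ("We require a lemma which
provides elementary geometric assertions. Since there is no multi-scale aspect present in the
proof it is omitted.").  The proof has two halves: (G) GEOMETRIC — under (13), for `α` small and
`x ∈ X ∖ 𝒩(∂X)` (neither `x` nor any of its six neighbours is a defect), the neighbourhood `𝒩(x)`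
is a *hexagonal wheel*: the six neighbours can be listed counter-clockwise `p₀, …, p₅` around
`y(x)` so that consecutive ones are short-range pairs, non-consecutive ones are not, and each
triangle `y(x), y(p_i), y(p_{i+1})` is positively oriented; (C) COMBINATORIAL — on a hexagonal
wheel the discrete imbeddings with `φ(x) = ξ`, `φ(p₀) = ξ'` are exactly the hexagon walk
`φ(p_i) = ξ + R^i (ξ' − ξ)`, `R` the rotation of `A₂` by `π/3` (continuity (19) and injectivity put
`φ(p_{i+1})` at lattice distance `1` from both `ξ` and `φ(p_i)`, i.e. `φ(p_{i+1}) − ξ = R^{±1}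
(φ(p_i) − ξ)`, and orientation (20) selects `+`).  This section proves (C)
(`IsHexagonalNbhd.exists_discreteImbedding`, `IsHexagonalNbhd.eqOn_of_discreteImbedding`,
`IsHexagonalNbhd.apply_rim_eq`); the wheel structure is the hypothesis `IsHexagonalNbhd`, and (G)
— that (13) and `x ∉ 𝒩(∂X)` produce it — is NOT proved here (it is the "elementary geometric"
content the paper omits; a separate brick). -/

section LocalImbedding

variable {X : Type*}

/-! ### The rotation of `A₂` by `π/3` in labels and the hexagon around a lattice point -/

/-- The rotation by `+π/3` of `A₂` in labels, `b₁ ↦ b₂ ↦ b₂ − b₁ ↦ −b₁ ↦ ⋯`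
(`(k₁, k₂) ↦ (−k₂, k₁ + k₂)`; = `Theil2006.rotN 1` of `Theil2006DistanceSet.lean`).
[cite: Theil2006, §4.2 proof of Lemma 4.6 (the matrix `R_{π/3}`, preprint p. 20)] -/
def rot60 (k : ℤ × ℤ) : ℤ × ℤ := (-k.2, k.1 + k.2)

/-- `rot60` is additive. [folklore] -/
private theorem rot60_add (a b : ℤ × ℤ) : rot60 (a + b) = rot60 a + rot60 b := by
  simp only [rot60, Prod.fst_add, Prod.snd_add, Prod.mk_add_mk, Prod.mk.injEq]
  constructor <;> ring

/-- `rot60` commutes with subtraction. [folklore] -/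
private theorem rot60_sub (a b : ℤ × ℤ) : rot60 (a - b) = rot60 a - rot60 b := by
  simp only [rot60, Prod.fst_sub, Prod.snd_sub, Prod.mk_sub_mk, Prod.mk.injEq]
  constructor <;> ring

/-- Iterates of `rot60` commute with subtraction. [folklore] -/
private theorem rot60_iterate_sub (n : ℕ) (a b : ℤ × ℤ) :
    rot60^[n] (a - b) = rot60^[n] a - rot60^[n] b := by
  induction n with
  | zero => rfl
  | succ n ih => rw [Function.iterate_succ_apply', Function.iterate_succ_apply',
      Function.iterate_succ_apply', ih, rot60_sub]

/-- Iterates of `rot60` commute with `rot60`. [folklore] -/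
private theorem rot60_iterate_rot60 (n : ℕ) (v : ℤ × ℤ) : rot60^[n] (rot60 v) = rot60 (rot60^[n] v) :=
  (Function.iterate_succ_apply rot60 n v).symm.trans (Function.iterate_succ_apply' rot60 n v)

/-- `rot60³ = −id` (rotation by `π`). [folklore] -/
private theorem rot60_iterate_three (k : ℤ × ℤ) : rot60^[3] k = -k := by
  ext <;>
    simp only [Function.iterate_succ, Function.iterate_zero, Function.comp_apply, id_eq, rot60,
      Prod.fst_neg, Prod.snd_neg] <;> ring

/-- `rot60⁶ = id`. [folklore] -/
private theorem rot60_iterate_six (k : ℤ × ℤ) : rot60^[6] k = k := by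
  rw [show (6 : ℕ) = 3 + 3 from rfl, Function.iterate_add_apply, rot60_iterate_three,
    rot60_iterate_three, neg_neg]

/-- `rot60` preserves the norm form, hence the length in `A₂`. [folklore] -/
private theorem norm_triPoint_rot60 (k : ℤ × ℤ) : ‖triPoint (rot60 k)‖ = ‖triPoint k‖ := by
  have h : ‖triPoint (rot60 k)‖ ^ 2 = ‖triPoint k‖ ^ 2 := by
    rw [norm_triPoint_sq, norm_triPoint_sq]
    simp only [rot60]
    push_cast
    ring
  rw [← Real.sqrt_sq (norm_nonneg (triPoint (rot60 k))), h, Real.sqrt_sq (norm_nonneg _)]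

/-- Iterates of `rot60` preserve the length. [folklore] -/
private theorem norm_triPoint_rot60_iterate (n : ℕ) (k : ℤ × ℤ) :
    ‖triPoint (rot60^[n] k)‖ = ‖triPoint k‖ := by
  induction n with
  | zero => rfl
  | succ n ih => rw [Function.iterate_succ_apply', norm_triPoint_rot60, ih]

/-- The cross product `k₁ k'₂ − k₂ k'₁` of labels; `det(triPoint k, triPoint k') = (√3/2)·cross`.
[folklore] -/
private def cross (k k' : ℤ × ℤ) : ℤ := k.1 * k'.2 - k.2 * k'.1

/-- `det₂` of two lattice vectors in labels. [cite: Theil2006, §2.3 Definition 2.4 (20) (preprint p. 7)] -/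
theorem det₂_triPoint (k k' : ℤ × ℤ) :
    det₂ (triPoint k) (triPoint k') = √3 / 2 * (k.1 * k'.2 - k.2 * k'.1 : ℤ) := by
  unfold det₂
  rw [triPoint_apply_zero, triPoint_apply_one, triPoint_apply_zero, triPoint_apply_one]
  push_cast
  ring

/-- `cross(k, R k) = |k|²` (norm form): a vector and its `π/3`-rotate are positively oriented.
[folklore] -/
private theorem cross_rot60 (k : ℤ × ℤ) : cross k (rot60 k) = k.1 ^ 2 + k.1 * k.2 + k.2 ^ 2 := by
  unfold cross rot60
  ring

/-- `cross(k, R⁵ k) = −|k|²`: a vector and its `−π/3`-rotate are negatively oriented. [folklore] -/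
private theorem cross_rot60_iterate_five (k : ℤ × ℤ) :
    cross k (rot60^[5] k) = -(k.1 ^ 2 + k.1 * k.2 + k.2 ^ 2) := by
  simp only [Function.iterate_succ, Function.iterate_zero, Function.comp_apply, id_eq, rot60,
    cross]
  ring

/-- The norm form is `1` on the unit shell. [folklore] -/
private theorem normForm_eq_one_of_mem_unitShell {v : ℤ × ℤ} (hv : v ∈ unitShell) :
    v.1 ^ 2 + v.1 * v.2 + v.2 ^ 2 = 1 := by
  simp only [unitShell, Finset.mem_insert, Finset.mem_singleton] at hv
  rcases hv with rfl | rfl | rfl | rfl | rfl | rfl <;> norm_num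

/-- `rot60` maps the unit shell to itself. [folklore] -/
private theorem rot60_mem_unitShell {v : ℤ × ℤ} (hv : v ∈ unitShell) : rot60 v ∈ unitShell := by
  simp only [unitShell, Finset.mem_insert, Finset.mem_singleton] at hv
  rcases hv with rfl | rfl | rfl | rfl | rfl | rfl <;> decide

/-- Iterates of `rot60` map the unit shell to itself. [folklore] -/
private theorem rot60_iterate_mem_unitShell (n : ℕ) {v : ℤ × ℤ} (hv : v ∈ unitShell) :
    rot60^[n] v ∈ unitShell := by
  induction n with
  | zero => exact hv
  | succ n ih => rw [Function.iterate_succ_apply']; exact rot60_mem_unitShell ih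

/-- Consecutive vertices of the lattice hexagon are lattice neighbours: `R v − v` is a unit
vector for a unit vector `v`. [folklore] -/
private theorem rot60_sub_self_mem_unitShell {v : ℤ × ℤ} (hv : v ∈ unitShell) :
    rot60 v - v ∈ unitShell := by
  simp only [unitShell, Finset.mem_insert, Finset.mem_singleton] at hv
  rcases hv with rfl | rfl | rfl | rfl | rfl | rfl <;> decide

/-- **The common lattice neighbours of two adjacent lattice points.** If `u` and `u'` are unit
vectors of `A₂` at distance `1` from each other (`u' − u` a unit vector), then `u' = R u` or
`u' = R⁻¹ u = R⁵ u`: the two lattice points adjacent to both `0` and `u`. [cite: Theil2006, §4.2 proof of Proposition 2.8 (1) («In two dimensions (68) has at most two solutions», preprint p. 23)] -/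
theorem eq_rot60_or_eq_rot60_iterate_five {u u' : ℤ × ℤ} (hu : u ∈ unitShell)
    (hu' : u' ∈ unitShell) (h : u' - u ∈ unitShell) :
    u' = rot60 u ∨ u' = rot60^[5] u := by
  simp only [unitShell, Finset.mem_insert, Finset.mem_singleton] at hu hu'
  rcases hu with rfl | rfl | rfl | rfl | rfl | rfl <;>
    rcases hu' with rfl | rfl | rfl | rfl | rfl | rfl <;>
      first
      | (left; decide)
      | (right; decide)
      | (exfalso; revert h; decide)

/-! ### Hexagonal wheels and the hexagon walk -/

/-- **A hexagonal neighbourhood (wheel).** The combinatorial type of the neighbourhood `𝒩(x)`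
of a particle `x ∈ X ∖ 𝒩(∂X)` that the paper's omitted "elementary geometric considerations"
provide under (13): the `𝒮`-neighbours of `x` are six particles `p₀, …, p₅` (listed by `Fin 6`,
indices mod `6`), consecutive ones form short-range pairs, second and third neighbours along the
rim do not, and every triangle `y(x), y(p_i), y(p_{i+1})` is positively oriented
(counter-clockwise listing).  This is the HYPOTHESIS under which the combinatorial half of
Lemma 4.7 is proved below; deriving it from (13) is the geometric half (not in this file).
[cite: Theil2006, §4.2 Lemma 4.7 (preprint p. 20); §2.1 «neighborhood … mapped bijectively onto A₂ ∩ B(0,1)» (p. 4)] -/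
structure IsHexagonalNbhd (α : ℝ) (y : X → Plane) (x : X) (p : Fin 6 → X) : Prop where
  /-- the six rim particles are distinct -/
  injective : Function.Injective p
  /-- each rim particle is an `𝒮`-neighbour of the centre -/
  isShortRange_centre : ∀ i, IsShortRange α y x (p i)
  /-- every `𝒮`-neighbour of the centre is on the rim -/
  mem_range_of_isShortRange : ∀ ⦃x'⦄, IsShortRange α y x x' → x' ∈ Set.range p
  /-- consecutive rim particles are `𝒮`-neighbours -/
  isShortRange_succ : ∀ i, IsShortRange α y (p i) (p (i + 1))
  /-- second neighbours along the rim are not `𝒮`-neighbours -/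
  not_isShortRange_add_two : ∀ i, ¬ IsShortRange α y (p i) (p (i + 2))
  /-- opposite rim particles are not `𝒮`-neighbours -/
  not_isShortRange_add_three : ∀ i, ¬ IsShortRange α y (p i) (p (i + 3))
  /-- the rim is listed counter-clockwise around `y(x)` -/
  det_pos : ∀ i, 0 < det₂ (y (p i) - y x) (y (p (i + 1)) - y x)

/-- **The hexagon walk** `i ↦ ξ + R^i v` around `ξ ∈ A₂` starting at `ξ + v` (labels).
[cite: Theil2006, §4.2 Lemma 4.7 (preprint p. 20)] -/
def hexWalk (ξ v : ℤ × ℤ) (i : Fin 6) : ℤ × ℤ := ξ + rot60^[i.val] v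

namespace IsHexagonalNbhd

variable {α : ℝ} {y : X → Plane} {x : X} {p : Fin 6 → X}

/-- In `Fin 6`, `i + 2 + 2 + 2 = i`-type bookkeeping: `(i + 4) + 2 = i`. [folklore] -/
private theorem fin6_add_four_add_two (i : Fin 6) : i + 4 + 2 = i := by
  rw [add_assoc, show (4 : Fin 6) + 2 = 0 from rfl, add_zero]

/-- `(i + 3) + 3 = i` in `Fin 6`. [folklore] -/
private theorem fin6_add_three_add_three (i : Fin 6) : i + 3 + 3 = i := by
  rw [add_assoc, show (3 : Fin 6) + 3 = 0 from rfl, add_zero]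

/-- `(i + 5) + 1 = i` in `Fin 6`. [folklore] -/
private theorem fin6_add_five_add_one (i : Fin 6) : i + 5 + 1 = i := by
  rw [add_assoc, show (5 : Fin 6) + 1 = 0 from rfl, add_zero]

/-- **The short-range pairs on the rim are exactly the consecutive ones**: if `{p_i, p_j} ∈ 𝒮(y)`
then `j = i + 1` or `j = i − 1 = i + 5`. [cite: Theil2006, §4.2 Lemma 4.7 (preprint p. 20)] -/
theorem eq_add_one_or_eq_add_five (h : IsHexagonalNbhd α y x p) (hα : α < 1) {i j : Fin 6}
    (hij : IsShortRange α y (p i) (p j)) : j = i + 1 ∨ j = i + 5 := by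
  obtain ⟨d, rfl⟩ : ∃ d, j = i + d := ⟨j - i, (add_sub_cancel i j).symm⟩
  rcases (by decide : ∀ d : Fin 6, d = 0 ∨ d = 1 ∨ d = 2 ∨ d = 3 ∨ d = 4 ∨ d = 5) d with
    rfl | rfl | rfl | rfl | rfl | rfl
  · rw [add_zero] at hij
    exact absurd hij (not_isShortRange_self hα _)
  · exact Or.inl rfl
  · exact absurd hij (h.not_isShortRange_add_two i)
  · exact absurd hij (h.not_isShortRange_add_three i)
  · have h4 := h.not_isShortRange_add_two (i + 4)
    rw [fin6_add_four_add_two] at h4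
    exact absurd hij.symm h4
  · exact Or.inr rfl

/-- The centre is not on the rim. [cite: Theil2006, §4.2 Lemma 4.7 (preprint p. 20)] -/
theorem centre_ne (h : IsHexagonalNbhd α y x p) (hα : α < 1) (i : Fin 6) : x ≠ p i :=
  (h.isShortRange_centre i).ne hα

/-- The centre is not in the range of the rim listing. [cite: Theil2006, §4.2 Lemma 4.7 (preprint p. 20)] -/
theorem centre_not_mem_range (h : IsHexagonalNbhd α y x p) (hα : α < 1) : x ∉ Set.range p := by
  rintro ⟨i, hi⟩
  exact h.centre_ne hα i hi.symm

/-- **`𝒩(x) = {x, p₀, …, p₅}`.** [cite: Theil2006, §4.2 Lemma 4.7 (preprint p. 20)] -/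
theorem nbhdSet_eq (h : IsHexagonalNbhd α y x p) : nbhdSet α y x = insert x (Set.range p) := by
  ext x'
  rw [mem_nbhdSet_iff, Set.mem_insert_iff]
  constructor
  · rintro (rfl | hs)
    · exact Or.inl rfl
    · exact Or.inr (h.mem_range_of_isShortRange hs)
  · rintro (rfl | ⟨i, rfl⟩)
    · exact Or.inl rfl
    · exact Or.inr (h.isShortRange_centre i)

/-- **A particle with a hexagonal neighbourhood is not a defect** (`#𝒩(x) = 7`).
[cite: Theil2006, §2.1 (definition of ∂X(y), preprint p. 4)] -/
theorem not_mem_defectSet (h : IsHexagonalNbhd α y x p) (hα : α < 1) : x ∉ defectSet α y := by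
  rw [mem_defectSet_iff, not_not, h.nbhdSet_eq,
    Set.ncard_insert_of_notMem (h.centre_not_mem_range hα) (Set.finite_range p),
    ← Set.image_univ, Set.ncard_image_of_injective _ h.injective, Set.ncard_univ, Nat.card_fin]

/-! ### Uniqueness: every local discrete imbedding is the hexagon walk -/

/-- `det₂` is antisymmetric. [folklore] -/
private theorem det₂_swap (u v : Plane) : det₂ v u = -det₂ u v := by
  unfold det₂
  ring

/-- Cyclic relabelling of an oriented triangle does not change its oriented area:
`det(c − b, a − b) = det(b − a, c − a)`. [folklore] -/
private theorem det₂_cycle (a b c : Plane) : det₂ (c - b) (a - b) = det₂ (b - a) (c - a) := by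
  unfold det₂
  simp only [PiLp.sub_apply]
  ring

/-- **The step of the hexagon walk is forced.** For a discrete imbedding `φ` of a hexagonal
neighbourhood, `φ(p_{i+1}) − φ(x) = R (φ(p_i) − φ(x))`: by Remark 2.5 both `φ(p_{i+1}) − φ(x)`
and `φ(p_{i+1}) − φ(p_i)` are unit vectors, so `φ(p_{i+1}) − φ(x) = R^{±1}(φ(p_i) − φ(x))`, and
orientation (20) on the positively oriented triangle `x, p_i, p_{i+1}` excludes `R⁻¹`
(`det(u, R⁻¹u) < 0`). [cite: Theil2006, §4.2 Lemma 4.7 (preprint p. 20)] -/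
theorem sub_eq_rot60_of_discreteImbedding (h : IsHexagonalNbhd α y x p) (hα : α < 1)
    {φ : X → ℤ × ℤ} (hφ : IsDiscreteImbeddingOn α y (nbhdSet α y x) φ) (i : Fin 6) :
    φ (p (i + 1)) - φ x = rot60 (φ (p i) - φ x) := by
  have hx : x ∈ nbhdSet α y x := mem_nbhdSet_self x
  have hp : ∀ j, p j ∈ nbhdSet α y x := fun j => (h.isShortRange_centre j).mem_nbhdSet
  have hu : φ (p i) - φ x ∈ unitShell :=
    hφ.sub_mem_unitShell hα hx (hp i) (h.isShortRange_centre i)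
  have hu' : φ (p (i + 1)) - φ x ∈ unitShell :=
    hφ.sub_mem_unitShell hα hx (hp (i + 1)) (h.isShortRange_centre (i + 1))
  have hd : φ (p (i + 1)) - φ x - (φ (p i) - φ x) ∈ unitShell := by
    rw [sub_sub_sub_cancel_right]
    exact hφ.sub_mem_unitShell hα (hp i) (hp (i + 1)) (h.isShortRange_succ i)
  rcases eq_rot60_or_eq_rot60_iterate_five hu hu' hd with h1 | h5
  · exact h1
  · -- the `R⁻¹` branch contradicts orientation preservation (20)
    exfalso
    have h20 := hφ.orientationOn hx (hp i) (hp (i + 1)) (h.isShortRange_centre i)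
      (h.isShortRange_centre (i + 1)) (h.isShortRange_succ i)
    rw [← map_sub, ← map_sub, h5, det₂_triPoint] at h20
    have hc : ((φ (p i) - φ x).1 * (rot60^[5] (φ (p i) - φ x)).2 -
        (φ (p i) - φ x).2 * (rot60^[5] (φ (p i) - φ x)).1 : ℤ) = -1 := by
      have := cross_rot60_iterate_five (φ (p i) - φ x)
      unfold cross at this
      rw [this, normForm_eq_one_of_mem_unitShell hu]
    rw [hc] at h20
    have h3 : (0 : ℝ) < √3 := Real.sqrt_pos.2 (by norm_num)
    have := h.det_pos i
    push_cast at h20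
    nlinarith

/-- The hexagon walk is forced, index by index (auxiliary `ℕ`-indexed form). [cite: Theil2006, §4.2 Lemma 4.7 (preprint p. 20)] -/
private theorem apply_rim_eq_aux (h : IsHexagonalNbhd α y x p) (hα : α < 1) {φ : X → ℤ × ℤ}
    (hφ : IsDiscreteImbeddingOn α y (nbhdSet α y x) φ) (n : ℕ) :
    ∀ hn : n < 6, φ (p ⟨n, hn⟩) = φ x + rot60^[n] (φ (p 0) - φ x) := by
  induction n with
  | zero =>
    intro hn
    show φ (p 0) = φ x + (φ (p 0) - φ x)
    abel
  | succ n ih =>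
    intro hn
    have hn' : n < 6 := Nat.lt_of_succ_lt hn
    have step := h.sub_eq_rot60_of_discreteImbedding hα hφ ⟨n, hn'⟩
    have hsucc : (⟨n, hn'⟩ : Fin 6) + 1 = ⟨n + 1, hn⟩ := by
      ext
      rw [Fin.val_add]
      exact Nat.mod_eq_of_lt hn
    rw [hsucc] at step
    rw [eq_add_of_sub_eq step, ih hn', add_sub_cancel_left, Function.iterate_succ_apply', add_comm]

/-- **Uniqueness in Lemma 4.7, explicit form.** A discrete imbedding `φ` of a hexagonal
neighbourhood `𝒩(x)` is the hexagon walk: `φ(p_i) = φ(x) + R^i (φ(p₀) − φ(x))`.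
[cite: Theil2006, §4.2 Lemma 4.7 (preprint p. 20)] -/
theorem apply_rim_eq (h : IsHexagonalNbhd α y x p) (hα : α < 1) {φ : X → ℤ × ℤ}
    (hφ : IsDiscreteImbeddingOn α y (nbhdSet α y x) φ) (i : Fin 6) :
    φ (p i) = hexWalk (φ x) (φ (p 0) - φ x) i :=
  apply_rim_eq_aux h hα hφ i.val i.isLt

/-- **Uniqueness in Lemma 4.7.** Two discrete imbeddings of a hexagonal neighbourhood `𝒩(x)`
which agree at `x` and at one neighbour `x' = p₀` agree on `𝒩(x)`.
[cite: Theil2006, §4.2 Lemma 4.7 (preprint p. 20)] -/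
theorem eqOn_of_discreteImbedding (h : IsHexagonalNbhd α y x p) (hα : α < 1) {φ ψ : X → ℤ × ℤ}
    (hφ : IsDiscreteImbeddingOn α y (nbhdSet α y x) φ) (hψ : IsDiscreteImbeddingOn α y (nbhdSet α y x) ψ)
    (hx : φ x = ψ x) (h0 : φ (p 0) = ψ (p 0)) : Set.EqOn φ ψ (nbhdSet α y x) := by
  intro x' hx'
  rw [h.nbhdSet_eq] at hx'
  rcases hx' with rfl | ⟨i, rfl⟩
  · exact hx
  · rw [h.apply_rim_eq hα hφ i, h.apply_rim_eq hα hψ i, hx, h0]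

/-! ### Existence: the hexagon walk is a discrete imbedding -/

/-- `R^{(i+1).val} v = R (R^{i.val} v)` on `Fin 6` (for `i = 5` this is `R⁶ = id`). [folklore] -/
private theorem rot60_iterate_val_add_one (v : ℤ × ℤ) (i : Fin 6) :
    rot60^[(i + 1).val] v = rot60 (rot60^[i.val] v) := by
  rw [← Function.iterate_succ_apply' rot60 i.val v]
  obtain ⟨n, hn⟩ := i
  by_cases h5 : n = 5
  · subst h5
    show rot60^[0] v = rot60^[6] v
    rw [rot60_iterate_six]
    rfl
  · have hlt : n + 1 < 6 := by omega
    have : ((⟨n, hn⟩ : Fin 6) + 1).val = n + 1 := by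
      rw [Fin.val_add]
      simp only [Fin.val_one]
      exact Nat.mod_eq_of_lt hlt
    rw [this]

/-- Consecutive points of the hexagon walk are lattice neighbours.
[cite: Theil2006, §4.2 Lemma 4.7 (preprint p. 20)] -/
theorem hexWalk_add_one_sub (ξ v : ℤ × ℤ) (i : Fin 6) :
    hexWalk ξ v (i + 1) - hexWalk ξ v i = rot60^[i.val] (rot60 v - v) := by
  unfold hexWalk
  rw [add_sub_add_left_eq_sub, rot60_iterate_val_add_one, rot60_iterate_sub, rot60_iterate_rot60]

/-- The hexagon walk stays at lattice distance `1` from its centre.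
[cite: Theil2006, §4.2 Lemma 4.7 (preprint p. 20)] -/
theorem dist_hexWalk_centre {ξ v : ℤ × ℤ} (hv : v ∈ unitShell) (i : Fin 6) :
    dist (triPoint ξ) (triPoint (hexWalk ξ v i)) = 1 := by
  rw [dist_comm, dist_triPoint, hexWalk, add_sub_cancel_left, norm_triPoint_rot60_iterate,
    norm_triPoint_of_mem_unitShell hv]

/-- Consecutive points of the hexagon walk are at lattice distance `1`.
[cite: Theil2006, §4.2 Lemma 4.7 (preprint p. 20)] -/
theorem dist_hexWalk_succ {ξ v : ℤ × ℤ} (hv : v ∈ unitShell) (i : Fin 6) :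
    dist (triPoint (hexWalk ξ v i)) (triPoint (hexWalk ξ v (i + 1))) = 1 := by
  rw [dist_comm, dist_triPoint, hexWalk_add_one_sub, norm_triPoint_rot60_iterate,
    norm_triPoint_of_mem_unitShell (rot60_sub_self_mem_unitShell hv)]

/-- The hexagon walk is injective (six distinct vertices). [cite: Theil2006, §4.2 Lemma 4.7 (preprint p. 20)] -/
theorem hexWalk_injective {ξ v : ℤ × ℤ} (hv : v ∈ unitShell) : Function.Injective (hexWalk ξ v) := by
  intro i j hij
  unfold hexWalk at hij
  have hij' : rot60^[i.val] v = rot60^[j.val] v := add_left_cancel hij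
  have key : ∀ a b : ℕ, a < 6 → b < 6 → rot60^[a] v = rot60^[b] v → a = b := by
    intro a b ha hb hab
    simp only [unitShell, Finset.mem_insert, Finset.mem_singleton] at hv
    rcases hv with rfl | rfl | rfl | rfl | rfl | rfl <;>
      interval_cases a <;> interval_cases b <;>
        first
        | rfl
        | (exfalso; revert hab; decide)
  exact Fin.ext (key _ _ i.isLt j.isLt hij')

/-- The hexagon walk never returns to its centre. [cite: Theil2006, §4.2 Lemma 4.7 (preprint p. 20)] -/
theorem hexWalk_ne_centre {ξ v : ℤ × ℤ} (hv : v ∈ unitShell) (i : Fin 6) : hexWalk ξ v i ≠ ξ := by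
  intro h
  have h1 := dist_hexWalk_centre (ξ := ξ) hv i
  rw [h, dist_self] at h1
  exact zero_ne_one h1

/-- The oriented area of two consecutive spokes of the hexagon walk is positive:
`det(R^i v, R^{i+1} v) = √3/2 > 0`. [cite: Theil2006, §4.2 Lemma 4.7 (preprint p. 20)] -/
theorem det₂_hexWalk_pos {ξ v : ℤ × ℤ} (hv : v ∈ unitShell) (i : Fin 6) :
    0 < det₂ (triPoint (hexWalk ξ v i) - triPoint ξ) (triPoint (hexWalk ξ v (i + 1)) - triPoint ξ) := by
  rw [← map_sub, ← map_sub, hexWalk, hexWalk, add_sub_cancel_left, add_sub_cancel_left,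
    rot60_iterate_val_add_one, det₂_triPoint]
  have hc := cross_rot60 (rot60^[i.val] v)
  unfold cross at hc
  rw [hc, normForm_eq_one_of_mem_unitShell (rot60_iterate_mem_unitShell _ hv)]
  have h3 : (0 : ℝ) < √3 := Real.sqrt_pos.2 (by norm_num)
  push_cast
  linarith

/-- **Existence in Lemma 4.7.** On a hexagonal neighbourhood `𝒩(x)`, for lattice points
`ξ, ξ'` at distance `1` (`ξ' − ξ` a unit vector) the hexagon walk, extended by `x ↦ ξ`, is a
discrete imbedding `φ : 𝒩(x) → A₂` with `φ(x) = ξ`, `φ(p₀) = ξ'` (and `φ(p_i) = ξ + R^i(ξ' − ξ)`).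
Continuity (19): the short-range pairs inside `𝒩(x)` are the spokes and the consecutive rim
pairs, all mapped to lattice distance `1`; orientation (20): the `𝒮`-triangles inside `𝒩(x)` are
the `x, p_i, p_{i+1}`, positively oriented on both sides; injectivity: seven distinct lattice
points. [cite: Theil2006, §4.2 Lemma 4.7 (preprint p. 20)] -/
theorem exists_discreteImbedding (h : IsHexagonalNbhd α y x p) (hα : α < 1) {ξ ξ' : ℤ × ℤ}
    (hξ : ξ' - ξ ∈ unitShell) :
    ∃ φ : X → ℤ × ℤ, IsDiscreteImbeddingOn α y (nbhdSet α y x) φ ∧ φ x = ξ ∧ φ (p 0) = ξ' ∧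
      ∀ i, φ (p i) = hexWalk ξ (ξ' - ξ) i := by
  classical
  set v := ξ' - ξ with hv
  let φ : X → ℤ × ℤ := Function.extend p (hexWalk ξ v) fun _ => ξ
  have hφp : ∀ i, φ (p i) = hexWalk ξ v i := fun i => h.injective.extend_apply _ _ i
  have hφx : φ x = ξ := by
    show Function.extend p (hexWalk ξ v) (fun _ => ξ) x = ξ
    rw [Function.extend_apply' _ _ _ (fun ⟨i, hi⟩ => h.centre_ne hα i hi.symm)]
  have hN := h.nbhdSet_eq
  refine ⟨φ, ⟨?_, ?_, ?_⟩, hφx, by rw [hφp]; simp [hexWalk, hv], hφp⟩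
  · -- (19)
    intro x₁ hx₁ x₂ hx₂ hs
    rw [hN] at hx₁ hx₂
    rcases hx₁ with rfl | ⟨i, rfl⟩ <;> rcases hx₂ with rfl | ⟨j, rfl⟩
    · exact absurd hs (not_isShortRange_self hα _)
    · rw [hφx, hφp]
      exact (dist_hexWalk_centre hξ j).le
    · rw [hφx, hφp, dist_comm]
      exact (dist_hexWalk_centre hξ i).le
    · rcases h.eq_add_one_or_eq_add_five hα hs with rfl | rfl
      · rw [hφp, hφp]
        exact (dist_hexWalk_succ hξ i).le
      · rw [hφp, hφp, dist_comm]
        have h5 := dist_hexWalk_succ (ξ := ξ) hξ (i + 5)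
        rw [fin6_add_five_add_one] at h5
        exact h5.le
  · -- (20)
    intro x₁ hx₁ x₂ hx₂ x₃ hx₃ h₁₂ h₁₃ h₂₃
    rw [hN] at hx₁ hx₂ hx₃
    -- the base case `x₁ = x`, `{x₂, x₃} = {p i, p (i ± 1)}`
    have key : ∀ i j : Fin 6, IsShortRange α y (p i) (p j) →
        0 ≤ det₂ (y (p i) - y x) (y (p j) - y x) *
          det₂ (triPoint (φ (p i)) - triPoint (φ x)) (triPoint (φ (p j)) - triPoint (φ x)) := by
      intro i j hij
      rw [hφp, hφp, hφx]
      rcases h.eq_add_one_or_eq_add_five hα hij with rfl | rfl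
      · exact (mul_pos (h.det_pos i) (det₂_hexWalk_pos hξ i)).le
      · rw [det₂_swap (y (p (i + 5)) - y x) (y (p i) - y x),
          det₂_swap (triPoint (hexWalk ξ v (i + 5)) - triPoint ξ)
            (triPoint (hexWalk ξ v i) - triPoint ξ), neg_mul_neg]
        have h1 := h.det_pos (i + 5)
        have h2 := det₂_hexWalk_pos (ξ := ξ) hξ (i + 5)
        rw [fin6_add_five_add_one] at h1 h2
        exact (mul_pos h1 h2).le
    rcases hx₁ with h1 | ⟨i, rfl⟩ <;> rcases hx₂ with h2 | ⟨j, rfl⟩ <;>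
      rcases hx₃ with h3 | ⟨k, rfl⟩
    · rw [h1, h2] at h₁₂
      exact absurd h₁₂ (not_isShortRange_self hα _)
    · rw [h1, h2] at h₁₂
      exact absurd h₁₂ (not_isShortRange_self hα _)
    · rw [h1, h3] at h₁₃
      exact absurd h₁₃ (not_isShortRange_self hα _)
    · rw [h1]
      exact key j k h₂₃
    · rw [h2, h3] at h₂₃
      exact absurd h₂₃ (not_isShortRange_self hα _)
    · -- `(p i, x, p k)`: relabel the triangle cyclically twice
      rw [h2, det₂_cycle (y (p k)) (y (p i)) (y x), det₂_cycle (y x) (y (p k)) (y (p i)),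
        det₂_cycle (triPoint (φ (p k))) (triPoint (φ (p i))) (triPoint (φ x)),
        det₂_cycle (triPoint (φ x)) (triPoint (φ (p k))) (triPoint (φ (p i)))]
      exact key k i h₁₃.symm
    · -- `(p i, p j, x)`: relabel once
      rw [h3, det₂_cycle (y x) (y (p i)) (y (p j)),
        det₂_cycle (triPoint (φ x)) (triPoint (φ (p i))) (triPoint (φ (p j)))]
      exact key i j h₁₂
    · -- three rim particles pairwise adjacent: impossible on a hexagon
      exfalso
      rcases h.eq_add_one_or_eq_add_five hα h₁₂ with rfl | rfl <;>
        rcases h.eq_add_one_or_eq_add_five hα h₁₃ with rfl | rfl <;>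
          rcases h.eq_add_one_or_eq_add_five hα h₂₃ with e | e <;>
            · rw [add_assoc] at e
              exact absurd (add_left_cancel e) (by decide)
  · -- injectivity on `𝒩(x)`
    intro x₁ hx₁ x₂ hx₂ heq
    rw [hN] at hx₁ hx₂
    rcases hx₁ with rfl | ⟨i, rfl⟩ <;> rcases hx₂ with rfl | ⟨j, rfl⟩
    · rfl
    · rw [hφx, hφp] at heq
      exact absurd heq.symm (hexWalk_ne_centre hξ j)
    · rw [hφx, hφp] at heq
      exact absurd heq (hexWalk_ne_centre hξ i)
    · rw [hφp, hφp] at heq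
      rw [hexWalk_injective hξ heq]

end IsHexagonalNbhd

end LocalImbedding

/-! ## Lemma 4.7, geometric half: under (13) the neighbourhood of a particle off `𝒩(∂X)` is a
hexagonal wheel

The "elementary geometric considerations" the paper leaves out (Proposition 2.3: "The proof that
(13) implies (18) follows from elementary geometric considerations"; Lemma 4.7: "Since there is no
multi-scale aspect present in the proof it is omitted"), with the explicit threshold
`α ≤ α₀ = 1/200`.  In complex coordinates centred at a particle `q`, its `𝒮`-neighbours lie in the
annulus `1 − α ≤ |ζ| ≤ 1 + α` and are mutually `(1 − α)`-separated ((13)), so two of them subtend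
an angle `> 1` (radian) at `q` (law of cosines: the cosine is `< 53/100 < cos 1`); if `q` is not a
defect it has exactly six neighbours, whose angles, sorted counter-clockwise from any one of them,
therefore increase by gaps `∈ (1, 2π − 5)` (six gaps `> 1` summing to `2π`).  Consequences:
consecutive neighbours span a positively oriented triangle with `q`; non-consecutive ones are at
angular distance `≥ 2`, hence at distance `> √2 (1 − α) > 1 + α` — not `𝒮`-pairs; and if a
neighbour `p_i` is itself not a defect, its own clockwise-next neighbour after `q` sits within
`3α + ½ < 1 − α` of `p_{i+1}`, so by (13) it IS `p_{i+1}`: consecutive neighbours are `𝒮`-pairs.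
-/

section Geometry

open Complex (arg I)

variable {X : Type*} {α : ℝ} {y : X → Plane}

/-! ### Complex coordinates -/

/-- Complex coordinate of a plane vector (`ℝ² ≅ ℂ`, the isometry `orthonormalBasisOneI`). [folklore] -/
private def cx (v : Plane) : ℂ := Complex.orthonormalBasisOneI.repr.symm v

/-- `cx v = v₀ + v₁ i`. [folklore] -/
private theorem cx_apply (v : Plane) : cx v = v 0 + v 1 * I :=
  Complex.orthonormalBasisOneI_repr_symm_apply v

/-- `cx` is additive (subtraction). [folklore] -/
private theorem cx_sub (u v : Plane) : cx (u - v) = cx u - cx v := by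
  unfold cx
  exact map_sub _ _ _

/-- `cx` preserves norms. [folklore] -/
private theorem norm_cx (v : Plane) : ‖cx v‖ = ‖v‖ := by
  unfold cx
  exact LinearIsometryEquiv.norm_map _ _

/-- `cx` preserves distances. [folklore] -/
private theorem norm_cx_sub_cx (u v : Plane) : ‖cx u - cx v‖ = dist u v := by
  rw [← cx_sub, norm_cx, dist_eq_norm]

/-- `det(u, v) = Im(conj(u) v)` in complex coordinates. [folklore] -/
private theorem det₂_eq_im (u v : Plane) : det₂ u v = (starRingEnd ℂ (cx u) * cx v).im := by
  rw [cx_apply, cx_apply]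
  unfold det₂
  simp [Complex.mul_im]
  ring

/-- `Im(conj(z) w) = |z| |w| sin(arg w − arg z)`. [folklore] -/
private theorem im_conj_mul (z w : ℂ) :
    (starRingEnd ℂ z * w).im = ‖z‖ * ‖w‖ * Real.sin (arg w - arg z) := by
  have hz := Complex.norm_mul_cos_arg z
  have hz' := Complex.norm_mul_sin_arg z
  have hw := Complex.norm_mul_cos_arg w
  have hw' := Complex.norm_mul_sin_arg w
  simp only [Complex.mul_im, Complex.conj_re, Complex.conj_im, Real.sin_sub]
  rw [← hz, ← hz', ← hw, ← hw']
  ring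

/-! ### Numerical constants -/

/-- `cos 1 > 53/100` (`cos 1 = 2cos²(½) − 1`, `cos ½ ≥ 1 − ⅛`). [folklore] -/
private theorem cos_one_gt : (53 : ℝ) / 100 < Real.cos 1 := by
  have h : Real.cos 1 = 2 * Real.cos (1 / 2) ^ 2 - 1 := by
    rw [← Real.cos_two_mul]
    norm_num
  have h2 : 1 - (1 / 2 : ℝ) ^ 2 / 2 ≤ Real.cos (1 / 2) := Real.one_sub_sq_div_two_le_cos
  have h3 : (7 : ℝ) / 8 ≤ Real.cos (1 / 2) := by norm_num at h2 ⊢; linarith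
  rw [h]
  nlinarith [mul_le_mul h3 h3 (by norm_num) (by linarith)]

/-- `2π − 5 < 13/10` and friends: the numerical window for the angular gaps. [folklore] -/
private theorem two_pi_sub_five_lt : 2 * Real.pi - 5 < 13 / 10 := by
  linarith [Real.pi_lt_d2]

/-! ### Angular separation of two neighbours (law of cosines) -/

/-- Two points of the annulus `1 − α ≤ |·| ≤ 1 + α` at mutual distance `> 1 − α` (`α ≤ 1/200`)
subtend an angle with cosine `< 53/100`. [cite: Theil2006, §2.2 Proposition 2.3 (18) («elementary geometric considerations», preprint p. 7); our lemma] -/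
private theorem cos_arg_sub_arg_lt (hα : 0 < α) (hα' : α ≤ 1 / 200) {z w : ℂ}
    (hz : 1 - α ≤ ‖z‖) (hz' : ‖z‖ ≤ 1 + α) (hw : 1 - α ≤ ‖w‖) (hw' : ‖w‖ ≤ 1 + α)
    (hzw : 1 - α < ‖z - w‖) : Real.cos (arg z - arg w) < 53 / 100 := by
  by_contra! hcos
  have h1α : 0 ≤ 1 - α := by linarith
  have hsq : (1 - α) ^ 2 < ‖z - w‖ ^ 2 := by gcongr
  rw [norm_sub_sq_eq_cos_arg] at hsq
  have hzw1 : (1 - α) ^ 2 ≤ ‖z‖ * ‖w‖ := by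
    rw [sq]
    exact mul_le_mul hz hw h1α (norm_nonneg z)
  have hprod : (1 - α) ^ 2 * (53 / 100) ≤ ‖z‖ * ‖w‖ * Real.cos (arg z - arg w) := by
    calc (1 - α) ^ 2 * (53 / 100) ≤ ‖z‖ * ‖w‖ * (53 / 100) := by gcongr
      _ ≤ ‖z‖ * ‖w‖ * Real.cos (arg z - arg w) := by gcongr
  have hz2 : ‖z‖ ^ 2 ≤ (1 + α) ^ 2 := by gcongr
  have hw2 : ‖w‖ ^ 2 ≤ (1 + α) ^ 2 := by gcongr
  nlinarith [sq_nonneg α]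

/-- **Angular separation.** In the situation of `cos_arg_sub_arg_lt`, any real `t` with
`cos t = cos(arg z − arg w)` has `|t| > 1`: two `𝒮`-neighbours of a particle subtend more than one
radian at it. [cite: Theil2006, §2.2 Proposition 2.3 (18) («elementary geometric considerations», preprint p. 7); our lemma] -/
private theorem one_lt_abs_of_cos_eq (hα : 0 < α) (hα' : α ≤ 1 / 200) {z w : ℂ}
    (hz : 1 - α ≤ ‖z‖) (hz' : ‖z‖ ≤ 1 + α) (hw : 1 - α ≤ ‖w‖) (hw' : ‖w‖ ≤ 1 + α)
    (hzw : 1 - α < ‖z - w‖) {t : ℝ} (ht : Real.cos (arg z - arg w) = Real.cos t) : 1 < |t| := by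
  by_contra! hle
  have h1 : Real.cos 1 ≤ Real.cos t := by
    rw [← Real.cos_abs t]
    exact Real.cos_le_cos_of_nonneg_of_le_pi (abs_nonneg t) (by linarith [Real.pi_gt_three]) hle
  have h2 := cos_arg_sub_arg_lt hα hα' hz hz' hw hw' hzw
  linarith [cos_one_gt]

/-! ### The counter-clockwise enumeration of the six neighbours of a non-defect -/

/-- A counter-clockwise enumeration `p₀ = a, p₁, …, p₅` of the `𝒮`-neighbours of `q`, with
normalised angles `0 = θ₀ < θ₁ < ⋯ < θ₅ < 2π − 1` at `y(q)` measured from `y(a)`, consecutive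
angles more than `1` apart, `θ_i ≡ arg(y(p_i) − y(q)) − arg(y(a) − y(q)) (mod 2π)` (the private
bookkeeping gadget for the geometric half of Lemma 4.7). [cite: Theil2006, §4.2 Lemma 4.7 (preprint p. 20); our bookkeeping] -/
structure CcwNbhd (α : ℝ) (y : X → Plane) (q a : X) (p : Fin 6 → X) (θ : Fin 6 → ℝ) :
    Prop where
  p_zero : p 0 = a
  injective : Function.Injective p
  isShortRange : ∀ i, IsShortRange α y q (p i)
  mem_range : ∀ ⦃b⦄, IsShortRange α y q b → b ∈ Set.range p
  θ_zero : θ 0 = 0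
  strictMono : StrictMono θ
  gap : ∀ i : Fin 6, i ≠ 5 → θ i + 1 < θ (i + 1)
  θ_five : θ 5 < 2 * Real.pi - 1
  arg_eq : ∀ i, ∃ n : ℤ,
    arg (cx (y (p i) - y q)) = arg (cx (y a - y q)) + θ i + n * (2 * Real.pi)

/-- **Counter-clockwise enumeration of `𝒩(q) ∖ {q}`.** Let `y` satisfy (13)
(`|y(x) − y(x')| > 1 − α` for `x ≠ x'`, `0 < α ≤ 1/200`), let `q ∉ ∂X(y)` and let `a` be one of
its six `𝒮`-neighbours.  Then the neighbours can be listed `p₀ = a, p₁, …, p₅` with angles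
`0 = θ₀ < θ₁ < ⋯ < θ₅ < 2π − 1` (measured at `y(q)` counter-clockwise from `y(a)`), consecutive
angles differing by more than `1`. [cite: Theil2006, §4.2 Lemma 4.7 (preprint p. 20); §2.2 Proposition 2.3 (18) (p. 7); our lemma] -/
theorem exists_ccwNbhd (hα : 0 < α) (hα' : α ≤ 1 / 200)
    (hsep : ∀ x x' : X, x ≠ x' → 1 - α < dist (y x) (y x')) {q a : X}
    (hq : q ∉ defectSet α y) (ha : IsShortRange α y q a) :
    ∃ (p : Fin 6 → X) (θ : Fin 6 → ℝ), CcwNbhd α y q a p θ := by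
  classical
  have hα1 : α < 1 := by linarith
  -- the six neighbours as a finset
  set N : Finset X := (finite_neighbours hα1 hq).toFinset with hN
  have hmemN : ∀ b, b ∈ N ↔ IsShortRange α y q b := fun b => by
    rw [hN, Set.Finite.mem_toFinset]
    rfl
  have hcardN : N.card = 6 := by
    rw [hN, ← Set.ncard_eq_toFinset_card _ (finite_neighbours hα1 hq)]
    exact ncard_neighbours_eq_six hα1 hq
  have haN : a ∈ N := (hmemN a).2 ha
  -- complex coordinates centred at `y q`
  set ζ : X → ℂ := fun b => cx (y b - y q) with hζ
  have hnormζ : ∀ b, ‖ζ b‖ = dist (y q) (y b) := fun b => by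
    rw [hζ]
    simp only
    rw [cx_sub, norm_cx_sub_cx, dist_comm]
  have hann : ∀ b ∈ N, 1 - α ≤ ‖ζ b‖ ∧ ‖ζ b‖ ≤ 1 + α := fun b hb => by
    rw [hnormζ]
    exact ⟨((hmemN b).1 hb).le_dist, ((hmemN b).1 hb).dist_le⟩
  have hsepζ : ∀ b b', b ≠ b' → 1 - α < ‖ζ b - ζ b'‖ := fun b b' hbb' => by
    rw [hζ]
    simp only
    rw [cx_sub, cx_sub, sub_sub_sub_cancel_right, norm_cx_sub_cx]
    exact hsep b b' hbb'
  -- angles relative to `a`, normalised to `[0, 2π)`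
  have h2π : 0 < 2 * Real.pi := Real.two_pi_pos
  set φ : X → ℝ := fun b => toIcoMod h2π 0 (arg (ζ b) - arg (ζ a)) with hφ
  set n : X → ℤ := fun b => toIcoDiv h2π 0 (arg (ζ b) - arg (ζ a)) with hn
  have hφn : ∀ b, arg (ζ b) - arg (ζ a) = φ b + n b * (2 * Real.pi) := fun b => by
    rw [hφ, hn, ← zsmul_eq_mul]
    exact (toIcoMod_add_toIcoDiv_zsmul _ _ _).symm
  have hφmem : ∀ b, 0 ≤ φ b ∧ φ b < 2 * Real.pi := fun b => by
    have h := toIcoMod_mem_Ico h2π 0 (arg (ζ b) - arg (ζ a))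
    rw [zero_add] at h
    exact h
  have hφa : φ a = 0 := by
    rw [hφ]
    simp only [sub_self]
    exact toIcoMod_apply_left h2π 0  -- `toIcoMod p 0 0 = 0`
  have hcosφ : ∀ b b', Real.cos (arg (ζ b) - arg (ζ b')) = Real.cos (φ b - φ b') := fun b b' => by
    have : arg (ζ b) - arg (ζ b') = (φ b - φ b') + ((n b - n b' : ℤ) : ℝ) * (2 * Real.pi) := by
      have e1 := hφn b
      have e2 := hφn b'
      push_cast
      linarith
    rw [this, Real.cos_add_int_mul_two_pi]
  -- separation of the normalised angles
  have hsepφ : ∀ b ∈ N, ∀ b' ∈ N, b ≠ b' → 1 < |φ b - φ b'| ∧ |φ b - φ b'| < 2 * Real.pi - 1 := by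
    intro b hb b' hb' hbb'
    have key : ∀ t : ℝ, Real.cos (arg (ζ b) - arg (ζ b')) = Real.cos t → 1 < |t| := fun t ht =>
      one_lt_abs_of_cos_eq hα hα' (hann b hb).1 (hann b hb).2 (hann b' hb').1 (hann b' hb').2
        (hsepζ b b' hbb') ht
    refine ⟨key _ (hcosφ b b'), ?_⟩
    have h1 := key (|φ b - φ b'| - 2 * Real.pi) (by
      rw [hcosφ, ← Real.cos_abs (φ b - φ b'), Real.cos_sub_two_pi])
    have hlt : |φ b - φ b'| < 2 * Real.pi := by
      rw [abs_lt]
      constructor <;> linarith [hφmem b, hφmem b']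
    rw [abs_of_neg (by linarith)] at h1
    linarith
  have hφpos : ∀ b ∈ N, b ≠ a → 1 < φ b ∧ φ b < 2 * Real.pi - 1 := by
    intro b hb hba
    have h := hsepφ b hb a haN hba
    rw [hφa, sub_zero, abs_of_nonneg (hφmem b).1] at h
    exact h
  -- `φ` is injective on `N`; sort its six values
  have hinjφ : Set.InjOn φ ↑N := by
    intro b hb b' hb' hbb'
    by_contra hne
    have h := (hsepφ b (Finset.mem_coe.1 hb) b' (Finset.mem_coe.1 hb') hne).1
    rw [hbb', sub_self, abs_zero] at h
    linarith
  set Φ : Finset ℝ := N.image φ with hΦ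
  have hcardΦ : Φ.card = 6 := by rw [hΦ, Finset.card_image_of_injOn hinjφ, hcardN]
  set e : Fin 6 ↪o ℝ := Φ.orderEmbOfFin hcardΦ with he
  have hemem : ∀ i, ∃ b ∈ N, φ b = e i := fun i =>
    Finset.mem_image.1 (by rw [← hΦ]; exact Finset.orderEmbOfFin_mem Φ hcardΦ i)
  choose p hpN hpφ using hemem
  have hΦnonneg : ∀ t ∈ Φ, 0 ≤ t := by
    intro t ht
    obtain ⟨b, -, rfl⟩ := Finset.mem_image.1 ht
    exact (hφmem b).1
  have h0Φ : (0 : ℝ) ∈ Φ := Finset.mem_image.2 ⟨a, haN, hφa⟩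
  have he0 : e 0 = 0 := by
    have hmin : e 0 = Φ.min' ⟨0, h0Φ⟩ := by
      rw [he]
      exact Finset.orderEmbOfFin_zero hcardΦ (by norm_num)
    rw [hmin]
    exact le_antisymm (Finset.min'_le Φ 0 h0Φ) (Finset.le_min' Φ _ 0 hΦnonneg)
  have hp0 : p 0 = a := by
    apply hinjφ (Finset.mem_coe.2 (hpN 0)) (Finset.mem_coe.2 haN)
    rw [hpφ 0, he0, hφa]
  have hinjp : Function.Injective p := by
    intro i j hij
    apply e.injective
    rw [← hpφ i, ← hpφ j, hij]
  have hcover : ∀ ⦃b⦄, IsShortRange α y q b → b ∈ Set.range p := by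
    intro b hb
    have hbN : b ∈ N := (hmemN b).2 hb
    have hmem : φ b ∈ Set.range e := by
      rw [he, Finset.range_orderEmbOfFin, hΦ, Finset.coe_image]
      exact Set.mem_image_of_mem φ (Finset.mem_coe.2 hbN)
    obtain ⟨i, hi⟩ := hmem
    refine ⟨i, hinjφ (Finset.mem_coe.2 (hpN i)) (Finset.mem_coe.2 hbN) ?_⟩
    rw [hpφ i, hi]
  refine ⟨p, fun i => e i, hp0, hinjp, fun i => (hmemN _).1 (hpN i), hcover, he0, e.strictMono,
    ?_, ?_, ?_⟩
  · -- consecutive gaps exceed `1`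
    intro i hi
    have hlt : i < i + 1 := by
      rw [Fin.lt_def, Fin.val_add_one_of_lt (Fin.lt_last_iff_ne_last.2 hi)]
      exact Nat.lt_succ_self _
    have hne : p (i + 1) ≠ p i := fun h => (ne_of_gt hlt) (hinjp h)
    have h := (hsepφ (p (i + 1)) (hpN _) (p i) (hpN _) hne).1
    rw [hpφ, hpφ, abs_of_pos (sub_pos.2 (e.strictMono hlt))] at h
    linarith
  · -- the last angle is `< 2π − 1`
    have hne : p 5 ≠ a := by
      rw [← hp0]
      exact fun h => absurd (hinjp h) (by decide)
    have h := (hφpos (p 5) (hpN 5) hne).2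
    rwa [hpφ] at h
  · -- the angles are the arguments modulo `2π`
    intro i
    refine ⟨n (p i), ?_⟩
    have h := hφn (p i)
    rw [hpφ i] at h
    linarith


/-! ### Consequences of the enumeration: angles, orientation, non-adjacent pairs -/

/-- `exp((b + t + 2πn) i) = exp(b i) exp(t i)`. [folklore] -/
private theorem exp_mul_I_of_eq_add_int {a b t : ℝ} {n : ℤ} (h : a = b + t + n * (2 * Real.pi)) :
    Complex.exp (a * I) = Complex.exp (b * I) * Complex.exp (t * I) := by
  rw [h]
  push_cast
  rw [show ((b : ℂ) + t + (n : ℂ) * (2 * (Real.pi : ℂ))) * I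
      = b * I + t * I + (n : ℂ) * (2 * (Real.pi : ℂ) * I) by ring,
    Complex.exp_add, Complex.exp_add, Complex.exp_int_mul_two_pi_mul_I, mul_one]

/-- `|e^{ia} − e^{ib}| ≤ |a − b|` (chord ≤ arc). [folklore] -/
private theorem norm_exp_mul_I_sub_le (a b : ℝ) :
    ‖Complex.exp (a * I) - Complex.exp (b * I)‖ ≤ |a - b| := by
  have h : Complex.exp (a * I) - Complex.exp (b * I)
      = Complex.exp (b * I) * (Complex.exp (I * ((a - b : ℝ) : ℂ)) - 1) := by
    rw [mul_sub, mul_one, ← Complex.exp_add]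
    push_cast
    ring_nf
  rw [h, norm_mul, Complex.norm_exp_ofReal_mul_I, one_mul, ← Real.norm_eq_abs]
  exact Real.norm_exp_I_mul_ofReal_sub_one_le

/-- `e^{iπ/3} + e^{−iπ/3} = 1` (`2 cos(π/3) = 1`): the apex identity of the equilateral triangle.
[folklore] -/
private theorem exp_pi_div_three_add :
    Complex.exp (((Real.pi / 3 : ℝ) : ℂ) * I) + Complex.exp (((-(Real.pi / 3) : ℝ) : ℂ) * I) = 1 := by
  rw [Complex.exp_mul_I, Complex.exp_mul_I, ← Complex.ofReal_cos, ← Complex.ofReal_sin,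
    ← Complex.ofReal_cos, ← Complex.ofReal_sin, Real.cos_neg, Real.sin_neg, Real.cos_pi_div_three]
  push_cast
  ring

/-- `cos t ≤ cos 2 (< 0)` for `2 ≤ |t| ≤ 2π − 2`. [folklore] -/
private theorem cos_le_cos_two {t : ℝ} (h2 : 2 ≤ |t|) (h2' : |t| ≤ 2 * Real.pi - 2) :
    Real.cos t ≤ Real.cos 2 := by
  rw [← Real.cos_abs t]
  by_cases hπ : |t| ≤ Real.pi
  · exact Real.cos_le_cos_of_nonneg_of_le_pi (by norm_num) hπ h2
  · rw [← Real.cos_two_pi_sub]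
    exact Real.cos_le_cos_of_nonneg_of_le_pi (by norm_num) (by linarith) (by linarith)

/-- `|g − π/3| < 1/4` for `g ∈ (1, 2π − 5)`. [folklore] -/
private theorem abs_sub_pi_div_three_lt {g : ℝ} (hg1 : 1 < g) (hg2 : g < 2 * Real.pi - 5) :
    |g - Real.pi / 3| < 1 / 4 := by
  rw [abs_lt]
  constructor <;> linarith [Real.pi_lt_d2, Real.pi_gt_three]

namespace CcwNbhd

variable {q a : X} {p : Fin 6 → X} {θ : Fin 6 → ℝ}

/-- The six cases of `Fin 6`. [folklore] -/
private theorem fin6_cases (i : Fin 6) : i = 0 ∨ i = 1 ∨ i = 2 ∨ i = 3 ∨ i = 4 ∨ i = 5 := by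
  revert i
  decide

/-- The chain of angle inequalities `0 = θ₀`, `θ_k + 1 < θ_{k+1}`, `θ₅ < 2π − 1`. [folklore] -/
private theorem chain (E : CcwNbhd α y q a p θ) :
    θ 0 = 0 ∧ θ 0 + 1 < θ 1 ∧ θ 1 + 1 < θ 2 ∧ θ 2 + 1 < θ 3 ∧ θ 3 + 1 < θ 4 ∧ θ 4 + 1 < θ 5 ∧
      θ 5 < 2 * Real.pi - 1 :=
  ⟨E.θ_zero, E.gap 0 (by decide), E.gap 1 (by decide), E.gap 2 (by decide), E.gap 3 (by decide),
    E.gap 4 (by decide), E.θ_five⟩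

/-- Arguments versus normalised angles: `arg ζ_j − arg ζ_i ≡ θ_j − θ_i (mod 2π)`. [folklore] -/
private theorem exists_arg_sub_arg (E : CcwNbhd α y q a p θ) (i j : Fin 6) : ∃ n : ℤ,
    arg (cx (y (p j) - y q)) - arg (cx (y (p i) - y q)) = θ j - θ i + n * (2 * Real.pi) := by
  obtain ⟨ni, hi⟩ := E.arg_eq i
  obtain ⟨nj, hj⟩ := E.arg_eq j
  exact ⟨nj - ni, by push_cast; linarith⟩

/-- `cos(arg ζ_j − arg ζ_i) = cos(θ_j − θ_i)`. [folklore] -/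
private theorem cos_arg_sub_arg (E : CcwNbhd α y q a p θ) (i j : Fin 6) :
    Real.cos (arg (cx (y (p j) - y q)) - arg (cx (y (p i) - y q))) = Real.cos (θ j - θ i) := by
  obtain ⟨n, hn⟩ := exists_arg_sub_arg E i j
  rw [hn, Real.cos_add_int_mul_two_pi]

/-- `sin(arg ζ_j − arg ζ_i) = sin(θ_j − θ_i)`. [folklore] -/
private theorem sin_arg_sub_arg (E : CcwNbhd α y q a p θ) (i j : Fin 6) :
    Real.sin (arg (cx (y (p j) - y q)) - arg (cx (y (p i) - y q))) = Real.sin (θ j - θ i) := by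
  obtain ⟨n, hn⟩ := exists_arg_sub_arg E i j
  rw [hn, Real.sin_add_int_mul_two_pi]

/-- The directions: `e^{i arg ζ_j} = e^{i arg ζ_i} · e^{i(θ_j − θ_i)}`. [folklore] -/
private theorem exp_arg_eq (E : CcwNbhd α y q a p θ) (i j : Fin 6) :
    Complex.exp (arg (cx (y (p j) - y q)) * I)
      = Complex.exp (arg (cx (y (p i) - y q)) * I) * Complex.exp ((θ j - θ i : ℝ) * I) := by
  obtain ⟨n, hn⟩ := exists_arg_sub_arg E i j
  exact exp_mul_I_of_eq_add_int (by linarith)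

/-- **The consecutive gap** (including the wrap-around `p₅ → p₀`): there is `g ∈ (1, 2π − 5)` with
`e^{i arg ζ_{i+1}} = e^{i arg ζ_i} e^{ig}` and `sin(arg ζ_{i+1} − arg ζ_i) = sin g`. [folklore] -/
private theorem exists_gap (E : CcwNbhd α y q a p θ) (i : Fin 6) : ∃ g : ℝ,
    1 < g ∧ g < 2 * Real.pi - 5 ∧
      Complex.exp (arg (cx (y (p (i + 1)) - y q)) * I)
        = Complex.exp (arg (cx (y (p i) - y q)) * I) * Complex.exp (g * I) ∧
      Real.sin (arg (cx (y (p (i + 1)) - y q)) - arg (cx (y (p i) - y q))) = Real.sin g := by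
  obtain ⟨h0, h01, h12, h23, h34, h45, h5⟩ := chain E
  by_cases hi : i = 5
  · subst hi
    refine ⟨2 * Real.pi - θ 5, by linarith, by linarith, ?_, ?_⟩
    · rw [exp_arg_eq E 5 (5 + 1), show (5 : Fin 6) + 1 = 0 from by decide, h0]
      congr 1
      have hn : (0 : ℝ) - θ 5 = 0 + (2 * Real.pi - θ 5) + (-1 : ℤ) * (2 * Real.pi) := by
        push_cast
        ring
      rw [exp_mul_I_of_eq_add_int hn, Complex.ofReal_zero, zero_mul, Complex.exp_zero, one_mul]
    · rw [sin_arg_sub_arg E 5 (5 + 1), show (5 : Fin 6) + 1 = 0 from by decide, h0,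
        show (0 : ℝ) - θ 5 = (2 * Real.pi - θ 5) + (-1 : ℤ) * (2 * Real.pi) by push_cast; ring,
        Real.sin_add_int_mul_two_pi]
  · refine ⟨θ (i + 1) - θ i, by linarith [E.gap i hi], ?_, exp_arg_eq E i (i + 1),
      sin_arg_sub_arg E i (i + 1)⟩
    rcases fin6_cases i with rfl | rfl | rfl | rfl | rfl | rfl
    · show θ 1 - θ 0 < _
      linarith
    · show θ 2 - θ 1 < _
      linarith
    · show θ 3 - θ 2 < _
      linarith
    · show θ 4 - θ 3 < _
      linarith
    · show θ 5 - θ 4 < _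
      linarith
    · exact absurd rfl hi

/-- **Non-adjacent rim particles are at angular distance `∈ [2, 2π − 2]`.** [folklore] -/
private theorem two_le_abs_sub (E : CcwNbhd α y q a p θ) {i j : Fin 6} (hne : i ≠ j)
    (hadj : ¬(j = i + 1 ∨ i = j + 1)) : 2 ≤ |θ j - θ i| ∧ |θ j - θ i| ≤ 2 * Real.pi - 2 := by
  obtain ⟨h0, h01, h12, h23, h34, h45, h5⟩ := chain E
  rcases fin6_cases i with rfl | rfl | rfl | rfl | rfl | rfl <;>
    rcases fin6_cases j with rfl | rfl | rfl | rfl | rfl | rfl <;>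
      first
      | exact absurd rfl hne
      | exact absurd (by decide) hadj
      | (refine ⟨?_, abs_le.2 ⟨by linarith, by linarith⟩⟩
         first
         | exact le_abs.2 (Or.inl (by linarith))
         | exact le_abs.2 (Or.inr (by linarith)))

/-- Norms of the centred coordinates of the rim particles lie in `[1 − α, 1 + α]`. [folklore] -/
private theorem norm_mem (E : CcwNbhd α y q a p θ) (i : Fin 6) :
    1 - α ≤ ‖cx (y (p i) - y q)‖ ∧ ‖cx (y (p i) - y q)‖ ≤ 1 + α := by
  rw [cx_sub, norm_cx_sub_cx, dist_comm]
  exact ⟨(E.isShortRange i).le_dist, (E.isShortRange i).dist_le⟩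

/-- **Orientation.** Consecutive rim particles (counter-clockwise) span a positively oriented
triangle with the centre: `det(y(p_i) − y(q), y(p_{i+1}) − y(q)) = r_i r_{i+1} sin g > 0`.
[cite: Theil2006, §4.2 Lemma 4.7 (preprint p. 20); our lemma] -/
theorem det₂_pos (hα1 : α < 1) (E : CcwNbhd α y q a p θ) (i : Fin 6) :
    0 < det₂ (y (p i) - y q) (y (p (i + 1)) - y q) := by
  obtain ⟨g, hg1, hg2, -, hsin⟩ := exists_gap E i
  rw [det₂_eq_im, im_conj_mul, hsin]
  have hr := (norm_mem E i).1
  have hr' := (norm_mem E (i + 1)).1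
  have hgπ : g < Real.pi := by linarith [Real.pi_lt_d2]
  exact mul_pos (mul_pos (by linarith) (by linarith)) (Real.sin_pos_of_pos_of_lt_pi (by linarith) hgπ)

/-- **Non-adjacent rim particles are not `𝒮`-neighbours**: their angular distance at `y(q)` is
`≥ 2`, so `|y(p_i) − y(p_j)|² ≥ r_i² + r_j² − 2 r_i r_j cos 2 > 2(1 − α)² > (1 + α)²`.
[cite: Theil2006, §4.2 Lemma 4.7 (preprint p. 20); our lemma] -/
theorem not_isShortRange_of_not_adj (hα : 0 < α) (hα' : α ≤ 1 / 200) (E : CcwNbhd α y q a p θ)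
    {i j : Fin 6} (hne : i ≠ j) (hadj : ¬(j = i + 1 ∨ i = j + 1)) :
    ¬ IsShortRange α y (p i) (p j) := by
  intro hs
  have hd := hs.dist_le
  obtain ⟨h2, h2'⟩ := two_le_abs_sub E hne hadj
  have hcos : Real.cos (arg (cx (y (p i) - y q)) - arg (cx (y (p j) - y q))) ≤ Real.cos 2 := by
    rw [cos_arg_sub_arg E j i, ← Real.cos_abs, abs_sub_comm]
    have h := cos_le_cos_two h2 h2'
    rwa [← Real.cos_abs] at h
  have hsq := norm_sub_sq_eq_cos_arg (cx (y (p i) - y q)) (cx (y (p j) - y q))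
  have hL : ‖cx (y (p i) - y q) - cx (y (p j) - y q)‖ = dist (y (p i)) (y (p j)) := by
    rw [cx_sub, cx_sub, sub_sub_sub_cancel_right, norm_cx_sub_cx]
  rw [hL] at hsq
  obtain ⟨hri, hri'⟩ := norm_mem E i
  obtain ⟨hrj, hrj'⟩ := norm_mem E j
  have hc2 := Real.cos_two_neg
  have hprod : ‖cx (y (p i) - y q)‖ * ‖cx (y (p j) - y q)‖ *
      Real.cos (arg (cx (y (p i) - y q)) - arg (cx (y (p j) - y q))) ≤ 0 :=
    mul_nonpos_of_nonneg_of_nonpos (mul_nonneg (norm_nonneg _) (norm_nonneg _)) (by linarith)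
  have h1 : (1 - α) ^ 2 ≤ ‖cx (y (p i) - y q)‖ ^ 2 := pow_le_pow_left₀ (by linarith) hri 2
  have h2 : (1 - α) ^ 2 ≤ ‖cx (y (p j) - y q)‖ ^ 2 := pow_le_pow_left₀ (by linarith) hrj 2
  have h3 : dist (y (p i)) (y (p j)) ^ 2 ≤ (1 + α) ^ 2 := pow_le_pow_left₀ dist_nonneg hd 2
  have h4 : ‖cx (y (p i) - y q)‖ ^ 2 + ‖cx (y (p j) - y q)‖ ^ 2 ≤ dist (y (p i)) (y (p j)) ^ 2 := by
    rw [hsq]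
    linarith
  nlinarith [sq_nonneg α]

/-! ### The apex argument: consecutive rim particles of a non-defect rim particle are `𝒮`-pairs -/

/-- Triangle inequality for five terms. [folklore] -/
private theorem norm_five_le (A B C D F : ℂ) :
    ‖A - B - C + D + F‖ ≤ ‖A‖ + ‖B‖ + ‖C‖ + ‖D‖ + ‖F‖ := by
  calc ‖A - B - C + D + F‖ ≤ ‖A - B - C + D‖ + ‖F‖ := norm_add_le _ _
    _ ≤ ‖A - B - C‖ + ‖D‖ + ‖F‖ := by gcongr; exact norm_add_le _ _
    _ ≤ ‖A - B‖ + ‖C‖ + ‖D‖ + ‖F‖ := by gcongr; exact norm_sub_le _ _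
    _ ≤ ‖A‖ + ‖B‖ + ‖C‖ + ‖D‖ + ‖F‖ := by gcongr; exact norm_sub_le _ _

/-- **Consecutive rim particles are `𝒮`-neighbours when the rim particle is not a defect.**
Around `p_i ∉ ∂X`, the clockwise-next neighbour `w` after `q` lies within `3α + ½ < 1 − α` of
`p_{i+1}` (both are `O(α)`-close to the apex of the equilateral triangle on `y(q) y(p_i)`), so by
(13) `w = p_{i+1}`. [cite: Theil2006, §4.2 Lemma 4.7 (preprint p. 20); our lemma] -/
theorem isShortRange_succ (hα : 0 < α) (hα' : α ≤ 1 / 200)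
    (hsep : ∀ x x' : X, x ≠ x' → 1 - α < dist (y x) (y x')) (E : CcwNbhd α y q a p θ) (i : Fin 6)
    (hpi : p i ∉ defectSet α y) : IsShortRange α y (p i) (p (i + 1)) := by
  obtain ⟨p', θ', E'⟩ := exists_ccwNbhd hα hα' hsep hpi (E.isShortRange i).symm
  -- `p' 5` is the clockwise-next neighbour of `p i` after `q`; we show it is `p (i + 1)`
  suffices hweq : p' 5 = p (i + 1) by
    have h5 := E'.isShortRange 5
    rwa [hweq] at h5
  by_contra hne
  have hfar := hsep (p' 5) (p (i + 1)) hne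
  -- the centred coordinates and their norms
  obtain ⟨hrU, hrU'⟩ := norm_mem E i
  obtain ⟨hrV, hrV'⟩ := norm_mem E (i + 1)
  obtain ⟨hrW, hrW'⟩ := norm_mem E' 5
  obtain ⟨g, hg1, hg2, hgexp, -⟩ := exists_gap E i
  obtain ⟨n, hn⟩ := E'.arg_eq 5
  obtain ⟨h0', h01', h12', h23', h34', h45', h5'⟩ := chain E'
  set U : ℂ := cx (y (p i) - y q) with hU
  set V : ℂ := cx (y (p (i + 1)) - y q) with hV
  set W : ℂ := cx (y (p' 5) - y (p i)) with hW
  set U' : ℂ := cx (y q - y (p i)) with hU'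
  set rU : ℝ := ‖U‖ with hrUdef
  set rV : ℝ := ‖V‖ with hrVdef
  set rW : ℝ := ‖W‖ with hrWdef
  have hrUpos : 0 < rU := by linarith
  have hne0 : (rU : ℂ) ≠ 0 := by exact_mod_cast hrUpos.ne'
  set u : ℂ := Complex.exp (arg U * I) with hu
  have hu1 : ‖u‖ = 1 := Complex.norm_exp_ofReal_mul_I _
  -- `U = rU u`, `V = rV u e^{ig}`
  have hUeq : U = (rU : ℂ) * u := (Complex.norm_mul_exp_arg_mul_I U).symm
  have hVeq : V = (rV : ℂ) * (u * Complex.exp ((g : ℂ) * I)) := by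
    have h1 := (Complex.norm_mul_exp_arg_mul_I V).symm
    rw [hgexp] at h1
    exact h1
  -- around `p i`: `U' = −U`, `e^{i arg U'} = −u`, `W = rW (−u) e^{−ih}`
  have hU'eq : U' = -U := by
    rw [hU', hU, cx_sub, cx_sub]
    ring
  have hexpU' : Complex.exp (arg U' * I) = -u := by
    have h1 : (‖U'‖ : ℂ) * Complex.exp (arg U' * I) = U' := Complex.norm_mul_exp_arg_mul_I U'
    have h2 : ‖U'‖ = rU := by rw [hU'eq, norm_neg]
    rw [h2] at h1
    have h3 : (rU : ℂ) * Complex.exp (arg U' * I) = (rU : ℂ) * (-u) := by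
      rw [h1, hU'eq, hUeq, mul_neg]
    exact mul_left_cancel₀ hne0 h3
  set h : ℝ := 2 * Real.pi - θ' 5 with hh
  have hh1 : 1 < h := by linarith
  have hh2 : h < 2 * Real.pi - 5 := by linarith
  have hexpW : Complex.exp (arg W * I) = -u * Complex.exp (((-h : ℝ) : ℂ) * I) := by
    have hn' : arg W = arg U' + (-h) + ((n + 1 : ℤ) : ℝ) * (2 * Real.pi) := by
      rw [hW, hU']
      push_cast
      linarith
    rw [exp_mul_I_of_eq_add_int hn', hexpU']
  have hWeq : W = (rW : ℂ) * (-u * Complex.exp (((-h : ℝ) : ℂ) * I)) := by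
    have h1 := (Complex.norm_mul_exp_arg_mul_I W).symm
    rw [hexpW] at h1
    exact h1
  -- the difference `y(p' 5) − y(p (i+1))` in complex coordinates
  have hdiff : cx (y (p' 5)) - cx (y (p (i + 1))) = W + U - V := by
    rw [hW, hU, hV, cx_sub, cx_sub, cx_sub]
    ring
  have hdist : dist (y (p' 5)) (y (p (i + 1))) = ‖W + U - V‖ := by
    rw [← hdiff, norm_cx_sub_cx]
  -- `W + U − V = u · (small terms)`, using `1 = e^{iπ/3} + e^{−iπ/3}`
  set eg : ℂ := Complex.exp ((g : ℂ) * I) with heg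
  set eh : ℂ := Complex.exp (((-h : ℝ) : ℂ) * I) with heh
  have hapex := exp_pi_div_three_add
  have hD : W + U - V = u * ((((rU - 1 : ℝ)) : ℂ) - (((rW - 1 : ℝ)) : ℂ) * eh
      - (((rV - 1 : ℝ)) : ℂ) * eg
      + (Complex.exp (((-(Real.pi / 3) : ℝ) : ℂ) * I) - eh)
      + (Complex.exp (((Real.pi / 3 : ℝ) : ℂ) * I) - eg)) := by
    rw [hWeq, hVeq, hUeq]
    simp only [Complex.ofReal_sub, Complex.ofReal_one]
    linear_combination (-u) * hapex
  have hnorm : ‖W + U - V‖ ≤ |rU - 1| + |rW - 1| + |rV - 1| + |h - Real.pi / 3|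
      + |g - Real.pi / 3| := by
    rw [hD, norm_mul, hu1, one_mul]
    refine (norm_five_le _ _ _ _ _).trans ?_
    have n1 : ‖(((rU - 1 : ℝ)) : ℂ)‖ = |rU - 1| := by
      rw [Complex.norm_real, Real.norm_eq_abs]
    have n2 : ‖(((rW - 1 : ℝ)) : ℂ) * eh‖ = |rW - 1| := by
      rw [norm_mul, heh, Complex.norm_exp_ofReal_mul_I, mul_one, Complex.norm_real,
        Real.norm_eq_abs]
    have n3 : ‖(((rV - 1 : ℝ)) : ℂ) * eg‖ = |rV - 1| := by
      rw [norm_mul, heg, Complex.norm_exp_ofReal_mul_I, mul_one, Complex.norm_real,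
        Real.norm_eq_abs]
    have n4 : ‖Complex.exp (((-(Real.pi / 3) : ℝ) : ℂ) * I) - eh‖ ≤ |h - Real.pi / 3| := by
      rw [heh]
      refine (norm_exp_mul_I_sub_le _ _).trans_eq ?_
      rw [show -(Real.pi / 3) - -h = h - Real.pi / 3 by ring]
    have n5 : ‖Complex.exp (((Real.pi / 3 : ℝ) : ℂ) * I) - eg‖ ≤ |g - Real.pi / 3| := by
      rw [heg]
      exact (norm_exp_mul_I_sub_le _ _).trans_eq (abs_sub_comm _ _)
    rw [n1, n2, n3]
    linarith
  have hb1 : |rU - 1| ≤ α := abs_le.2 ⟨by linarith, by linarith⟩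
  have hb2 : |rW - 1| ≤ α := abs_le.2 ⟨by linarith, by linarith⟩
  have hb3 : |rV - 1| ≤ α := abs_le.2 ⟨by linarith, by linarith⟩
  have hb4 := abs_sub_pi_div_three_lt hh1 hh2
  have hb5 := abs_sub_pi_div_three_lt hg1 hg2
  rw [hdist] at hfar
  linarith

end CcwNbhd

/-! ### Assembly: Lemma 4.7 -/

/-- **Lemma 4.7, geometric half.** Let `y` satisfy (13) with `0 < α ≤ 1/200`, and let
`x ∈ X ∖ 𝒩(∂X)` — `x` is not a defect and none of its `𝒮`-neighbours is.  Then `𝒩(x)` is a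
hexagonal wheel (`IsHexagonalNbhd`), listed counter-clockwise from any prescribed neighbour `x'`.
[cite: Theil2006, §4.2 Lemma 4.7 (preprint p. 20)] -/
theorem exists_isHexagonalNbhd (hα : 0 < α) (hα' : α ≤ 1 / 200)
    (hsep : ∀ x x' : X, x ≠ x' → 1 - α < dist (y x) (y x')) {x x' : X}
    (hx : x ∉ defectSet α y) (hN : ∀ ⦃b⦄, IsShortRange α y x b → b ∉ defectSet α y)
    (hx' : IsShortRange α y x x') :
    ∃ p : Fin 6 → X, p 0 = x' ∧ IsHexagonalNbhd α y x p := by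
  have hα1 : α < 1 := by linarith
  obtain ⟨p, θ, E⟩ := exists_ccwNbhd hα hα' hsep hx hx'
  exact ⟨p, E.p_zero, E.injective, E.isShortRange, E.mem_range,
    fun i => E.isShortRange_succ hα hα' hsep i (hN (E.isShortRange i)),
    fun i => E.not_isShortRange_of_not_adj hα hα' (by revert i; decide) (by revert i; decide),
    fun i => E.not_isShortRange_of_not_adj hα hα' (by revert i; decide) (by revert i; decide),
    fun i => E.det₂_pos hα1 i⟩

/-- **Lemma 4.7 (Theil 2006, Appendix): existence.** Under (13) with `0 < α ≤ 1/200`, for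
`x ∈ X ∖ 𝒩(∂X)`, `x' ∈ 𝒩(x) ∖ {x}` and lattice points `ξ, ξ'` with `|ξ − ξ'| = 1`, there is a
discrete imbedding `φ : 𝒩(x) → A₂` with `φ(x) = ξ` and `φ(x') = ξ'`.
[cite: Theil2006, §4.2 Lemma 4.7 (preprint p. 20)] -/
theorem exists_discreteImbedding_nbhd (hα : 0 < α) (hα' : α ≤ 1 / 200)
    (hsep : ∀ x x' : X, x ≠ x' → 1 - α < dist (y x) (y x')) {x x' : X}
    (hx : x ∉ defectSet α y) (hN : ∀ ⦃b⦄, IsShortRange α y x b → b ∉ defectSet α y)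
    (hx' : IsShortRange α y x x') {ξ ξ' : ℤ × ℤ} (hξ : ξ' - ξ ∈ unitShell) :
    ∃ φ : X → ℤ × ℤ, IsDiscreteImbeddingOn α y (nbhdSet α y x) φ ∧ φ x = ξ ∧ φ x' = ξ' := by
  obtain ⟨p, hp0, H⟩ := exists_isHexagonalNbhd hα hα' hsep hx hN hx'
  obtain ⟨φ, hφ, hφx, hφ0, -⟩ := H.exists_discreteImbedding (by linarith) hξ
  exact ⟨φ, hφ, hφx, by rw [← hp0]; exact hφ0⟩

/-- **Lemma 4.7 (Theil 2006, Appendix): uniqueness.** Under (13) with `0 < α ≤ 1/200`, for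
`x ∈ X ∖ 𝒩(∂X)` and `x' ∈ 𝒩(x) ∖ {x}`, two discrete imbeddings `𝒩(x) → A₂` that agree at `x`
and at `x'` agree on all of `𝒩(x)`. [cite: Theil2006, §4.2 Lemma 4.7 (preprint p. 20)] -/
theorem eqOn_nbhd_of_discreteImbedding (hα : 0 < α) (hα' : α ≤ 1 / 200)
    (hsep : ∀ x x' : X, x ≠ x' → 1 - α < dist (y x) (y x')) {x x' : X}
    (hx : x ∉ defectSet α y) (hN : ∀ ⦃b⦄, IsShortRange α y x b → b ∉ defectSet α y)
    (hx' : IsShortRange α y x x') {φ ψ : X → ℤ × ℤ}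
    (hφ : IsDiscreteImbeddingOn α y (nbhdSet α y x) φ)
    (hψ : IsDiscreteImbeddingOn α y (nbhdSet α y x) ψ)
    (h₁ : φ x = ψ x) (h₂ : φ x' = ψ x') : Set.EqOn φ ψ (nbhdSet α y x) := by
  obtain ⟨p, hp0, H⟩ := exists_isHexagonalNbhd hα hα' hsep hx hN hx'
  exact H.eqOn_of_discreteImbedding (by linarith) hφ hψ h₁ (by rw [hp0]; exact h₂)

/-- **Lemma 4.7, the rider "`conv(y(𝒩(x))) ∩ y(X) = y(𝒩(x))`".** Under (13) the particles lying
in the convex hull of `y(𝒩(x))` are exactly those of `𝒩(x)`: the hull lies in the closed ball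
`B(y(x), 1 + α)` (a convex set containing `y(𝒩(x))`), and by (13) every particle `b ≠ x` in that
ball is at distance `∈ (1 − α, 1 + α]` from `y(x)`, i.e. `{x, b} ∈ 𝒮(y)`.  (This holds for every
`x`, defect or not.) [cite: Theil2006, §4.2 Lemma 4.7 (preprint p. 20)] -/
theorem convexHull_image_nbhdSet_inter_range (hα : 0 < α)
    (hsep : ∀ x x' : X, x ≠ x' → 1 - α < dist (y x) (y x')) (x : X) :
    convexHull ℝ (y '' nbhdSet α y x) ∩ Set.range y = y '' nbhdSet α y x := by
  apply Set.Subset.antisymm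
  · rintro _ ⟨hz, ⟨b, rfl⟩⟩
    refine Set.mem_image_of_mem y ?_
    have hball : convexHull ℝ (y '' nbhdSet α y x) ⊆ Metric.closedBall (y x) (1 + α) := by
      refine convexHull_min ?_ (convex_closedBall _ _)
      rintro _ ⟨x', hx', rfl⟩
      rw [mem_nbhdSet_iff] at hx'
      rw [Metric.mem_closedBall, dist_comm]
      rcases hx' with rfl | hs
      · rw [dist_self]
        linarith
      · exact hs.dist_le
    have hd : dist (y b) (y x) ≤ 1 + α := Metric.mem_closedBall.1 (hball hz)
    by_cases hb : b = x
    · rw [hb]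
      exact mem_nbhdSet_self x
    · refine IsShortRange.mem_nbhdSet (abs_le.2 ⟨?_, ?_⟩)
      · linarith [hsep x b (Ne.symm hb)]
      · linarith [dist_comm (y x) (y b)]
  · exact Set.subset_inter (subset_convexHull ℝ _) (Set.image_subset_range _ _)

end Geometry

/-! ## Definition 4.4 (discrete paths), the rotations `Q_γ(k)` of (59) and the Burgers vector;
Remark 4.5 (Appendix §4.2, preprint pp. 19–20)

Source, verbatim.  **Definition 4.4.** "A map `γ : [0, K] ∩ ℕ → X` is a discrete path of length
`K` if `{γ(k), γ(k+1)} ∈ 𝒮` for all `k ∈ {0 … K − 1}`. A path `γ` is closed if `γ(K) = γ(0)`. A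
closed path is simple if `γ|_{{0…K−1}}` is injective.  Let `γ ⊂ X ∖ ∂X` be a closed, simple path.
The set `Ω(γ) ⊂ ℝ²` is the unique bounded domain which has the property
`∂Ω(γ) = ∪_k [y(γ(k)), y(γ(k+1))]` whose existence is guaranteed by Jordan's curve theorem. We say
that `γ` is positively oriented if `γ` passes through `∂Ω(γ)` in the positive sense."
(p. 20) "The matrix `Q_γ(k) ∈ SO(2)` is the unique rotation matrix which satisfies the equation
(59) `Q φ(γ(k − 1)) + φ(γ(k + 1)) = 0`,
where `φ : 𝒩(γ(k)) → A₂` is a an arbitrary discrete imbedding such that `φ(γ(k)) = 0`.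
The Burgers vector associated to simple closed path `γ` and a direction `v ∈ A₂` is defined by
`b(γ, v) = Σ_{k=0}^{K−1} Π_{i=0}^{k} Q_γ(i) v`, where `Q_γ(0) = Id` and `γ_K = γ_0`.
Since `SO(2)` is an Abelian group the Burgers vector `b` is well-defined without further
stipulation concerning the order in which the matrices are multiplied."
**Remark 4.5.** "It is obvious from the definition that closed paths `γ` with length smaller or
equal than two satisfy `vol(Ω(γ)) = b(γ, v) = 0`. On the other hand, if `γ` is an arbitrary closed
and simple path with `vol(Ω(γ)) = 0`, then the length of `γ` is smaller or equal to two. […] If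
all possible Burgers vectors are `0` then the configuration is a deformed subset of the lattice
`A₂`; a precise version of this connection is given in the statement and the proof of
Proposition 4.8.  On the other hand, because of Lemma 4.7 the matrix `Q` is independent of the
choice of `φ`.  The map `φ` can be reconstructed from (59) by treating `γ(k + 1)` as unknown."

Rendering.  A path is a map `γ : ℕ → X` read together with its length `K` (values past `K` are
ignored).  In (59) the vectors `φ(γ(k ± 1))` are unit vectors of `A₂` (Remark 2.5:
`γ(k ± 1) ∈ 𝒩(γ(k)) ∖ {γ(k)}`, `φ(γ(k)) = 0`), and the rotations `Q ∈ SO(2)` mapping a unit vector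
of `A₂` to a unit vector of `A₂` are exactly the six powers `R^j`, `j ∈ ℤ/6`, of the rotation `R` by
`π/3` (`rot60` in labels); we therefore record `Q_γ(k)` by its exponent
`turn α y γ k : Fin 6`, DEFINED, as printed ("`φ` … arbitrary"), as the exponent `j` for which (59)
`R^j φ(γ(k−1)) + φ(γ(k+1)) = 0` holds for every discrete imbedding `φ` of `𝒩(γ(k))` with
`φ(γ(k)) = 0` (junk value if there is no such exponent).  That this is a definition — Remark 4.5:
"because of Lemma 4.7 the matrix `Q` is independent of the choice of `φ`" — is the content of
`turn_spec` ((59) holds for every `φ`) and `turn_unique` ((59) for one `φ` determines the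
exponent) below, proved under the hypotheses of Lemma 4.7 at `γ(k)` ((13), `0 < α ≤ 1/200`,
`γ(k) ∉ 𝒩(∂X)`); on a hexagonal wheel around `γ(k)` listed from `p₀ = γ(k−1)`, with
`γ(k+1) = p_b`, the exponent is `b + 3` (`turn_eq_add_three`).  The Burgers vector is
`burgersVector α y γ K v = Σ_{k<K} R^{t₁ + ⋯ + t_k} v` in labels (`t_i = turn α y γ i`; the `k = 0`
term is `v`: "`Q_γ(0) = Id`"), for any label `v`.  Proved: the `b(γ, v) = 0` half of the first
sentence of Remark 4.5 (`burgersVector_eq_zero_of_length_le_two`), and, on the perfect lattice,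
`b(γ, γ(1) − γ(0)) = γ(K) − γ(0)` for every discrete lattice path (`burgersVector_triPoint`), so
that closed lattice paths have vanishing Burgers vector (the model case of "if all possible
Burgers vectors are `0` then the configuration is a deformed subset of the lattice").
NOT rendered here: `Ω(γ)`, positive orientation and `vol(Ω(γ))` (they rest on the Jordan curve
theorem, which Mathlib does not have), hence neither the `vol` parts of Remark 4.5 nor Lemma 4.6.
-/

section Paths

variable {X : Type*} (α : ℝ) (y : X → Plane)

/-- **Definition 4.4, discrete path of length `K`.** `γ : ℕ → X` (read on `{0, …, K}`) with
`{γ(k), γ(k+1)} ∈ 𝒮(y)` for all `k < K`. [cite: Theil2006, §4.2 Definition 4.4 (preprint p. 19)] -/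
def IsDiscretePath (γ : ℕ → X) (K : ℕ) : Prop :=
  ∀ ⦃k : ℕ⦄, k < K → IsShortRange α y (γ k) (γ (k + 1))

/-- **Definition 4.4, closed path**: a discrete path of length `K` with `γ(K) = γ(0)`.
[cite: Theil2006, §4.2 Definition 4.4 (preprint p. 19)] -/
def IsClosedPath (γ : ℕ → X) (K : ℕ) : Prop :=
  IsDiscretePath α y γ K ∧ γ K = γ 0

/-- **Definition 4.4, simple closed path**: a closed path whose restriction to `{0, …, K − 1}` is
injective. [cite: Theil2006, §4.2 Definition 4.4 (preprint p. 19)] -/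
def IsSimpleClosedPath (γ : ℕ → X) (K : ℕ) : Prop :=
  IsClosedPath α y γ K ∧ Set.InjOn γ (Set.Iio K)

open Classical in
/-- **(59): the rotation `Q_γ(k)`, recorded by its exponent.** `turn α y γ k = j` is the exponent
`j ∈ ℤ/6` such that `R^j φ(γ(k−1)) + φ(γ(k+1)) = 0` (`R` = `rot60`, the rotation by `π/3` in
labels) for every discrete imbedding `φ : 𝒩(γ(k)) → A₂` with `φ(γ(k)) = 0` — i.e.
`Q_γ(k) = R^j ∈ SO(2)` is "the unique rotation matrix which satisfies
`Q φ(γ(k−1)) + φ(γ(k+1)) = 0`, where `φ` is an arbitrary discrete imbedding such that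
`φ(γ(k)) = 0`"; junk value when no such exponent exists (off the hypotheses of Lemma 4.7, or at
`k = 0`, where the paper sets `Q_γ(0) = Id` and `burgersVector` does not use `turn`).
[cite: Theil2006, §4.2 (59) (preprint p. 20)] -/
def turn (γ : ℕ → X) (k : ℕ) : Fin 6 :=
  if h : ∃ j : Fin 6, ∀ φ : X → ℤ × ℤ, IsDiscreteImbeddingOn α y (nbhdSet α y (γ k)) φ →
      φ (γ k) = 0 → rot60^[j.val] (φ (γ (k - 1))) + φ (γ (k + 1)) = 0
  then h.choose else 0

/-- **The Burgers vector** `b(γ, v) = Σ_{k=0}^{K−1} (Π_{i=0}^{k} Q_γ(i)) v` with `Q_γ(0) = Id`, in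
labels: the `k`-th term is `R^{t₁ + ⋯ + t_k} v`, `t_i = turn α y γ i` (the `k = 0` term is `v`).
[cite: Theil2006, §4.2 (Burgers vector, preprint p. 20)] -/
def burgersVector (γ : ℕ → X) (K : ℕ) (v : ℤ × ℤ) : ℤ × ℤ :=
  ∑ k ∈ Finset.range K, rot60^[∑ i ∈ Finset.Icc 1 k, (turn α y γ i).val] v

variable {α y}

/-- A discrete path of length `K` is one of every smaller length. [cite: Theil2006, §4.2 Definition 4.4 (preprint p. 19)] -/
theorem IsDiscretePath.mono {γ : ℕ → X} {K K' : ℕ} (h : IsDiscretePath α y γ K) (hK : K' ≤ K) :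
    IsDiscretePath α y γ K' :=
  fun _ hk => h (lt_of_lt_of_le hk hK)

/-- Every map is a discrete path of length `0`. [cite: Theil2006, §4.2 Definition 4.4 (preprint p. 19)] -/
theorem isDiscretePath_zero (γ : ℕ → X) : IsDiscretePath α y γ 0 :=
  fun k hk => absurd hk (Nat.not_lt_zero k)

/-- A simple closed path is closed. [cite: Theil2006, §4.2 Definition 4.4 (preprint p. 19)] -/
theorem IsSimpleClosedPath.isClosedPath {γ : ℕ → X} {K : ℕ} (h : IsSimpleClosedPath α y γ K) :
    IsClosedPath α y γ K :=
  h.1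

/-- There is no closed path of length `1` (for `α < 1`): `{γ(0), γ(1)} ∈ 𝒮` forces
`γ(1) ≠ γ(0)`. [cite: Theil2006, §4.2 Definition 4.4 (preprint p. 19); our remark] -/
theorem IsClosedPath.length_ne_one (hα : α < 1) {γ : ℕ → X} {K : ℕ} (h : IsClosedPath α y γ K) :
    K ≠ 1 := by
  rintro rfl
  have h1 : IsShortRange α y (γ 0) (γ (0 + 1)) := h.1 one_pos
  rw [zero_add, h.2] at h1
  exact not_isShortRange_self hα _ h1

/-! ### `rot60` acts freely on `ℤ² ∖ {0}` -/

/-- `R^{6q} = id`. [folklore] -/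
private theorem rot60_iterate_six_mul (q : ℕ) (w : ℤ × ℤ) : rot60^[6 * q] w = w := by
  induction q with
  | zero => rfl
  | succ q ih => rw [Nat.mul_succ, Function.iterate_add_apply, rot60_iterate_six, ih]

/-- The exponent of `R` only matters modulo `6`. [folklore] -/
private theorem rot60_iterate_mod_six (n : ℕ) (w : ℤ × ℤ) : rot60^[n % 6] w = rot60^[n] w := by
  conv_rhs => rw [← Nat.mod_add_div n 6, Function.iterate_add_apply, rot60_iterate_six_mul]

/-- Iterates of `R` fix the origin. [folklore] -/
private theorem rot60_iterate_zero (n : ℕ) : rot60^[n] (0 : ℤ × ℤ) = 0 := by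
  induction n with
  | zero => rfl
  | succ n ih => rw [Function.iterate_succ_apply', ih]; rfl

/-- Iterates of `R` commute with negation. [folklore] -/
private theorem rot60_iterate_neg (n : ℕ) (w : ℤ × ℤ) : rot60^[n] (-w) = -rot60^[n] w := by
  have h := rot60_iterate_sub n 0 w
  rwa [zero_sub, rot60_iterate_zero, zero_sub] at h

/-- Iterates of `R` do not kill non-zero vectors. [folklore] -/
private theorem rot60_iterate_ne_zero (n : ℕ) {u : ℤ × ℤ} (hu : u ≠ 0) : rot60^[n] u ≠ 0 := by
  intro h
  apply hu
  have h1 : ‖triPoint (rot60^[n] u)‖ = ‖triPoint u‖ := norm_triPoint_rot60_iterate n u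
  rw [h, map_zero, norm_zero] at h1
  have h2 : triPoint u = 0 := norm_eq_zero.1 h1.symm
  exact triPoint_injective (by rw [h2, map_zero])

/-- A non-trivial power `R^d`, `0 < d < 6`, fixes only the origin. [folklore] -/
private theorem rot60_iterate_ne_self {d : ℕ} (hd : d < 6) (hd0 : d ≠ 0) {u : ℤ × ℤ} (hu : u ≠ 0) :
    rot60^[d] u ≠ u := by
  intro h
  apply hu
  obtain ⟨u₁, u₂⟩ := u
  interval_cases d
  · exact absurd rfl hd0
  all_goals
    simp only [Function.iterate_succ, Function.iterate_zero, Function.comp_apply, id_eq, rot60,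
      Prod.mk.injEq] at h
    obtain ⟨h1, h2⟩ := h
    refine Prod.ext ?_ ?_ <;> simp only [Prod.fst_zero, Prod.snd_zero] <;> omega

/-- **`R` acts freely on `A₂ ∖ {0}`**: the exponent `j ∈ ℤ/6` with `R^j u = w` is unique for
`u ≠ 0`. [folklore] -/
private theorem fin_eq_of_rot60_iterate_eq {i j : Fin 6} {u : ℤ × ℤ} (hu : u ≠ 0)
    (h : rot60^[i.val] u = rot60^[j.val] u) : i = j := by
  suffices key : ∀ a b : Fin 6, a.val ≤ b.val → rot60^[a.val] u = rot60^[b.val] u → a = b by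
    rcases le_total i.val j.val with hij | hij
    · exact key i j hij h
    · exact (key j i hij h.symm).symm
  intro a b hab heq
  obtain ⟨d, hd⟩ := Nat.exists_eq_add_of_le hab
  by_contra hne
  have hd6 : d < 6 := by have := b.isLt; omega
  have hd0 : d ≠ 0 := by
    rintro rfl
    exact hne (Fin.ext (by omega))
  have hw : rot60^[d] (rot60^[a.val] u) = rot60^[a.val] u := by
    rw [← Function.iterate_add_apply, show d + a.val = b.val by omega, ← heq]
  exact rot60_iterate_ne_self hd6 hd0 (rot60_iterate_ne_zero a.val hu) hw

/-! ### (59) on a hexagonal wheel -/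

namespace IsHexagonalNbhd

variable {x : X} {p : Fin 6 → X}

/-- On a hexagonal wheel, a discrete imbedding vanishing at the centre reads `φ(p_i) = R^i φ(p₀)`
(the hexagon walk of Lemma 4.7 from `ξ = 0`). [cite: Theil2006, §4.2 Lemma 4.7 (preprint p. 20)] -/
theorem apply_rim_eq_of_apply_centre (h : IsHexagonalNbhd α y x p) (hα : α < 1) {φ : X → ℤ × ℤ}
    (hφ : IsDiscreteImbeddingOn α y (nbhdSet α y x) φ) (h0 : φ x = 0) (i : Fin 6) :
    φ (p i) = rot60^[i.val] (φ (p 0)) := by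
  rw [h.apply_rim_eq hα hφ i, hexWalk, h0, sub_zero, zero_add]

/-- A discrete imbedding vanishing at the centre does not vanish on the rim (injectivity).
[cite: Theil2006, §2.3 Definition 2.4 (preprint p. 7)] -/
theorem apply_rim_ne_zero (h : IsHexagonalNbhd α y x p) (hα : α < 1) {φ : X → ℤ × ℤ}
    (hφ : IsDiscreteImbeddingOn α y (nbhdSet α y x) φ) (h0 : φ x = 0) (i : Fin 6) :
    φ (p i) ≠ 0 := by
  intro hi
  have hmem : p i ∈ nbhdSet α y x := (h.isShortRange_centre i).mem_nbhdSet
  exact h.centre_ne hα i (hφ.injOn (mem_nbhdSet_self x) hmem (h0.trans hi.symm))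

/-- **(59) solved on a wheel.** Listing the wheel around `γ(k)` from `p₀ = γ(k−1)`, with
`γ(k+1) = p_b`: `R^{b+3} φ(p₀) + φ(p_b) = 0` for EVERY discrete imbedding `φ` of the
neighbourhood with `φ(centre) = 0` (`φ(p_b) = R^b φ(p₀)` and `R³ = −id`).
[cite: Theil2006, §4.2 (59) and Remark 4.5 (preprint p. 20)] -/
theorem rot60_iterate_add_three_add (h : IsHexagonalNbhd α y x p) (hα : α < 1) {φ : X → ℤ × ℤ}
    (hφ : IsDiscreteImbeddingOn α y (nbhdSet α y x) φ) (h0 : φ x = 0) (b : Fin 6) :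
    rot60^[(b + 3).val] (φ (p 0)) + φ (p b) = 0 := by
  rw [h.apply_rim_eq_of_apply_centre hα hφ h0 b, Fin.val_add,
    show ((3 : Fin 6) : ℕ) = 3 from rfl, rot60_iterate_mod_six, Nat.add_comm,
    Function.iterate_add_apply, rot60_iterate_three, neg_add_cancel]

/-- **(59) determines the exponent on a wheel**: if `R^j φ(p₀) + φ(p_b) = 0` for one discrete
imbedding `φ` with `φ(centre) = 0`, then `j = b + 3`.
[cite: Theil2006, §4.2 (59) and Remark 4.5 (preprint p. 20)] -/
theorem eq_add_three_of_rot60_iterate_add (h : IsHexagonalNbhd α y x p) (hα : α < 1)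
    {φ : X → ℤ × ℤ} (hφ : IsDiscreteImbeddingOn α y (nbhdSet α y x) φ) (h0 : φ x = 0)
    {b j : Fin 6} (hj : rot60^[j.val] (φ (p 0)) + φ (p b) = 0) : j = b + 3 := by
  have h1 := h.rot60_iterate_add_three_add hα hφ h0 b
  refine fin_eq_of_rot60_iterate_eq (h.apply_rim_ne_zero hα hφ h0 0) ?_
  rw [eq_neg_of_add_eq_zero_left hj, eq_neg_of_add_eq_zero_left h1]

end IsHexagonalNbhd

/-! ### `Q_γ(k)` is well defined (Remark 4.5 via Lemma 4.7) -/

/-- **The exponent on a wheel.** If the neighbourhood of `γ(k)` is a hexagonal wheel listed from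
`p₀ = γ(k−1)` and `γ(k+1) = p_b`, then `turn α y γ k = b + 3` (needs `α < 1` only: the wheel
carries a discrete imbedding, Lemma 4.7). [cite: Theil2006, §4.2 (59), Remark 4.5 (preprint p. 20)] -/
theorem turn_eq_add_three (hα1 : α < 1) {γ : ℕ → X} {k : ℕ} {p : Fin 6 → X}
    (H : IsHexagonalNbhd α y (γ k) p) (hp0 : p 0 = γ (k - 1)) {b : Fin 6} (hb : p b = γ (k + 1)) :
    turn α y γ k = b + 3 := by
  classical
  have hex : ∃ j : Fin 6, ∀ φ : X → ℤ × ℤ, IsDiscreteImbeddingOn α y (nbhdSet α y (γ k)) φ →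
      φ (γ k) = 0 → rot60^[j.val] (φ (γ (k - 1))) + φ (γ (k + 1)) = 0 := by
    refine ⟨b + 3, fun φ hφ h0 => ?_⟩
    rw [← hp0, ← hb]
    exact H.rot60_iterate_add_three_add hα1 hφ h0 b
  rw [turn, dif_pos hex]
  have hξ : ((1, 0) : ℤ × ℤ) - 0 ∈ unitShell := by decide
  obtain ⟨φ₀, hφ₀, hφ₀x, -, -⟩ := H.exists_discreteImbedding hα1 hξ
  have hj : rot60^[hex.choose.val] (φ₀ (p 0)) + φ₀ (p b) = 0 := by
    rw [hp0, hb]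
    exact hex.choose_spec φ₀ hφ₀ hφ₀x
  exact H.eq_add_three_of_rot60_iterate_add hα1 hφ₀ hφ₀x hj

/-- **(59) holds for every discrete imbedding (Remark 4.5: "`Q` is independent of the choice of
`φ`", by Lemma 4.7).**  Under (13) with `0 < α ≤ 1/200`, at an index `k` with
`γ(k) ∈ X ∖ 𝒩(∂X)` and `γ(k ± 1) ∈ 𝒩(γ(k)) ∖ {γ(k)}`:
`R^{turn} φ(γ(k−1)) + φ(γ(k+1)) = 0` for every discrete imbedding `φ` of `𝒩(γ(k))` with
`φ(γ(k)) = 0`. [cite: Theil2006, §4.2 (59), Remark 4.5 (preprint p. 20)] -/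
theorem turn_spec (hα : 0 < α) (hα' : α ≤ 1 / 200)
    (hsep : ∀ x x' : X, x ≠ x' → 1 - α < dist (y x) (y x')) {γ : ℕ → X} {k : ℕ}
    (hk : γ k ∉ defectSet α y) (hN : ∀ ⦃b⦄, IsShortRange α y (γ k) b → b ∉ defectSet α y)
    (hprev : IsShortRange α y (γ k) (γ (k - 1))) (hnext : IsShortRange α y (γ k) (γ (k + 1)))
    {φ : X → ℤ × ℤ} (hφ : IsDiscreteImbeddingOn α y (nbhdSet α y (γ k)) φ) (h0 : φ (γ k) = 0) :
    rot60^[(turn α y γ k).val] (φ (γ (k - 1))) + φ (γ (k + 1)) = 0 := by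
  obtain ⟨p, hp0, H⟩ := exists_isHexagonalNbhd hα hα' hsep hk hN hprev
  obtain ⟨b, hb⟩ := H.mem_range_of_isShortRange hnext
  rw [turn_eq_add_three (by linarith) H hp0 hb, ← hp0, ← hb]
  exact H.rot60_iterate_add_three_add (by linarith) hφ h0 b

/-- **(59) determines `Q_γ(k)`**: under the same hypotheses, if `R^j φ(γ(k−1)) + φ(γ(k+1)) = 0`
for one discrete imbedding `φ` of `𝒩(γ(k))` with `φ(γ(k)) = 0`, then `j = turn α y γ k` ("the
unique rotation matrix which satisfies (59)"). [cite: Theil2006, §4.2 (59) (preprint p. 20)] -/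
theorem turn_unique (hα : 0 < α) (hα' : α ≤ 1 / 200)
    (hsep : ∀ x x' : X, x ≠ x' → 1 - α < dist (y x) (y x')) {γ : ℕ → X} {k : ℕ}
    (hk : γ k ∉ defectSet α y) (hN : ∀ ⦃b⦄, IsShortRange α y (γ k) b → b ∉ defectSet α y)
    (hprev : IsShortRange α y (γ k) (γ (k - 1))) (hnext : IsShortRange α y (γ k) (γ (k + 1)))
    {φ : X → ℤ × ℤ} (hφ : IsDiscreteImbeddingOn α y (nbhdSet α y (γ k)) φ) (h0 : φ (γ k) = 0)
    {j : Fin 6} (hj : rot60^[j.val] (φ (γ (k - 1))) + φ (γ (k + 1)) = 0) : j = turn α y γ k := by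
  obtain ⟨p, hp0, H⟩ := exists_isHexagonalNbhd hα hα' hsep hk hN hprev
  obtain ⟨b, hb⟩ := H.mem_range_of_isShortRange hnext
  rw [turn_eq_add_three (by linarith) H hp0 hb]
  rw [← hp0, ← hb] at hj
  exact H.eq_add_three_of_rot60_iterate_add (by linarith) hφ h0 hj

/-- "The map `φ` can be reconstructed from (59) by treating `γ(k + 1)` as unknown":
`φ(γ(k+1)) = −R^{turn} φ(γ(k−1))`. [cite: Theil2006, §4.2 Remark 4.5 (preprint p. 20)] -/
theorem apply_next_eq (hα : 0 < α) (hα' : α ≤ 1 / 200)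
    (hsep : ∀ x x' : X, x ≠ x' → 1 - α < dist (y x) (y x')) {γ : ℕ → X} {k : ℕ}
    (hk : γ k ∉ defectSet α y) (hN : ∀ ⦃b⦄, IsShortRange α y (γ k) b → b ∉ defectSet α y)
    (hprev : IsShortRange α y (γ k) (γ (k - 1))) (hnext : IsShortRange α y (γ k) (γ (k + 1)))
    {φ : X → ℤ × ℤ} (hφ : IsDiscreteImbeddingOn α y (nbhdSet α y (γ k)) φ) (h0 : φ (γ k) = 0) :
    φ (γ (k + 1)) = -rot60^[(turn α y γ k).val] (φ (γ (k - 1))) :=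
  eq_neg_of_add_eq_zero_right (turn_spec hα hα' hsep hk hN hprev hnext hφ h0)

/-! ### The Burgers vector: recursion and Remark 4.5 -/

/-- `b(γ, v)` of the empty path is `0`. [cite: Theil2006, §4.2 (Burgers vector, preprint p. 20)] -/
@[simp] theorem burgersVector_zero (γ : ℕ → X) (v : ℤ × ℤ) : burgersVector α y γ 0 v = 0 := by
  simp [burgersVector]

/-- One more step: `b_{K+1}(γ, v) = b_K(γ, v) + R^{t₁ + ⋯ + t_K} v`.
[cite: Theil2006, §4.2 (Burgers vector, preprint p. 20)] -/
theorem burgersVector_succ (γ : ℕ → X) (K : ℕ) (v : ℤ × ℤ) :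
    burgersVector α y γ (K + 1) v =
      burgersVector α y γ K v + rot60^[∑ i ∈ Finset.Icc 1 K, (turn α y γ i).val] v := by
  rw [burgersVector, Finset.sum_range_succ, ← burgersVector]

/-- `b₁(γ, v) = v` ("`Q_γ(0) = Id`"). [cite: Theil2006, §4.2 (Burgers vector, preprint p. 20)] -/
@[simp] theorem burgersVector_one (γ : ℕ → X) (v : ℤ × ℤ) : burgersVector α y γ 1 v = v := by
  simp [burgersVector]

/-- **Remark 4.5, first sentence (Burgers half): closed paths of length `≤ 2` have
`b(γ, v) = 0`.**  (Length `0`: empty sum; length `1` does not occur; length `2`: `γ = (x, x', x)`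
and (59) at `k = 1` reads `Q φ(x) + φ(x) = 0`, so `Q = R³ = −Id` and `b = v − v`.)  Hypotheses:
(13), `0 < α ≤ 1/200`, and `γ ⊂ X ∖ 𝒩(∂X)` on the indices `0 < k < K` where `Q_γ(k)` is used.
[cite: Theil2006, §4.2 Remark 4.5 (preprint p. 20)] -/
theorem burgersVector_eq_zero_of_length_le_two (hα : 0 < α) (hα' : α ≤ 1 / 200)
    (hsep : ∀ x x' : X, x ≠ x' → 1 - α < dist (y x) (y x')) {γ : ℕ → X} {K : ℕ}
    (hγ : IsClosedPath α y γ K) (hK : K ≤ 2)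
    (hreg : ∀ ⦃k : ℕ⦄, 0 < k → k < K →
      γ k ∉ defectSet α y ∧ ∀ ⦃b⦄, IsShortRange α y (γ k) b → b ∉ defectSet α y)
    (v : ℤ × ℤ) : burgersVector α y γ K v = 0 := by
  have hα1 : α < 1 := by linarith
  interval_cases K
  · exact burgersVector_zero γ v
  · exact absurd rfl (hγ.length_ne_one hα1)
  · obtain ⟨h1, hN1⟩ := hreg one_pos one_lt_two
    have h01 : IsShortRange α y (γ 0) (γ (0 + 1)) := hγ.1 two_pos
    have h12 : IsShortRange α y (γ 1) (γ (1 + 1)) := hγ.1 one_lt_two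
    have hprev : IsShortRange α y (γ 1) (γ (1 - 1)) := h01.symm
    obtain ⟨p, hp0, H⟩ := exists_isHexagonalNbhd hα hα' hsep h1 hN1 hprev
    have hb : p 0 = γ (1 + 1) := by rw [hp0]; exact hγ.2.symm
    have ht : turn α y γ 1 = 0 + 3 := turn_eq_add_three hα1 H hp0 hb
    rw [burgersVector_succ, burgersVector_one, show Finset.Icc 1 1 = {1} from rfl,
      Finset.sum_singleton, ht, zero_add, show ((3 : Fin 6) : ℕ) = 3 from rfl, rot60_iterate_three,
      add_neg_cancel]

/-! ### The perfect lattice: `b(γ, γ(1) − γ(0)) = γ(K) − γ(0)` -/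

/-- The perfect lattice satisfies (13) for every `α > 0`: distinct lattice points are at distance
`≥ 1`. [cite: Theil2006, §1 (A₂) and §2.2 (13) (preprint pp. 1, 6)] -/
theorem triPoint_sep (hα : 0 < α) (k k' : ℤ × ℤ) (h : k ≠ k') :
    1 - α < dist (triPoint k) (triPoint k') := by
  rw [dist_triPoint]
  have h1 : 1 ≤ ‖triPoint (k - k')‖ := one_le_norm_triPoint (sub_ne_zero.2 h)
  linarith

/-- Translates of the identity chart, `k ↦ k − c`, are discrete imbeddings of the perfect lattice
on every patch (`0 ≤ α < √3 − 1`). [cite: Theil2006, §2.3 Definition 2.4 (preprint p. 7); sanity check] -/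
theorem isDiscreteImbeddingOn_sub_const_triPoint (hα0 : 0 ≤ α) (hα : α < √3 - 1)
    (ω : Set (ℤ × ℤ)) (c : ℤ × ℤ) : IsDiscreteImbeddingOn α triPoint ω fun k => k - c := by
  refine ⟨fun k _ k' _ hs => ?_, fun k₁ _ k₂ _ k₃ _ _ _ _ => ?_, fun a _ b _ hab => ?_⟩
  · rw [dist_comm, dist_triPoint, sub_sub_sub_cancel_right,
      norm_triPoint_of_mem_unitShell ((isShortRange_triPoint_iff hα0 hα).1 hs)]
  · rw [← map_sub, ← map_sub, ← map_sub, ← map_sub, sub_sub_sub_cancel_right,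
      sub_sub_sub_cancel_right]
    exact mul_self_nonneg _
  · exact sub_left_injective hab

/-- **(59) on the perfect lattice**: for a discrete lattice path, `Q_γ(k)` rotates the incoming
step onto the outgoing one, `R^{t_k} (γ(k) − γ(k−1)) = γ(k+1) − γ(k)` (`0 < k < K`,
`0 < α ≤ 1/200`). [cite: Theil2006, §4.2 (59) (preprint p. 20); sanity check] -/
theorem rot60_iterate_turn_triPoint (hα : 0 < α) (hα' : α ≤ 1 / 200) {γ : ℕ → ℤ × ℤ} {K k : ℕ}
    (hγ : IsDiscretePath α triPoint γ K) (hk : 0 < k) (hkK : k < K) :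
    rot60^[(turn α triPoint γ k).val] (γ k - γ (k - 1)) = γ (k + 1) - γ k := by
  have hα3 : α < √3 - 1 := by
    have h3 : (1.7 : ℝ) < √3 := by
      rw [show (1.7 : ℝ) = √(1.7 ^ 2) by rw [Real.sqrt_sq]; norm_num]
      exact Real.sqrt_lt_sqrt (by norm_num) (by norm_num)
    linarith
  have hdef : defectSet α (triPoint : ℤ × ℤ → Plane) = ∅ := defectSet_triPoint_eq_empty hα.le hα3
  have hkd : γ k ∉ defectSet α triPoint := by simp [hdef]
  have hN : ∀ ⦃b⦄, IsShortRange α triPoint (γ k) b → b ∉ defectSet α triPoint :=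
    fun b _ => by simp [hdef]
  have hprev : IsShortRange α triPoint (γ k) (γ (k - 1)) := by
    have h := hγ (show k - 1 < K by omega)
    rw [Nat.sub_add_cancel hk] at h
    exact h.symm
  have hφ := isDiscreteImbeddingOn_sub_const_triPoint hα.le hα3 (nbhdSet α triPoint (γ k)) (γ k)
  have h := turn_spec hα hα' (fun a b hab => triPoint_sep hα a b hab) hkd hN hprev (hγ hkK) hφ
    (sub_self (γ k))
  -- `h : R^t (γ(k−1) − γ(k)) + (γ(k+1) − γ(k)) = 0`
  have h' := eq_neg_of_add_eq_zero_left h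
  rw [← neg_sub (γ (k - 1)) (γ k), rot60_iterate_neg, h', neg_neg]

/-- **Burgers vectors of the perfect lattice.** For a discrete lattice path of length `K`
(`y = triPoint`, `0 < α ≤ 1/200`) and the direction of its first step,
`b(γ, γ(1) − γ(0)) = γ(K) − γ(0)`: the `k`-th term of `b` is the `k`-th step (by (59), each `Q_γ(i)`
turns step `i − 1` onto step `i`), and the steps telescope.  In particular closed lattice paths
have `b = 0` (the model case behind "if all possible Burgers vectors are `0` then the
configuration is a deformed subset of the lattice `A₂`").
[cite: Theil2006, §4.2 Remark 4.5 (preprint p. 20); sanity check] -/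
theorem burgersVector_triPoint (hα : 0 < α) (hα' : α ≤ 1 / 200) {γ : ℕ → ℤ × ℤ} {K : ℕ}
    (hγ : IsDiscretePath α triPoint γ K) :
    burgersVector α triPoint γ K (γ 1 - γ 0) = γ K - γ 0 := by
  -- the `k`-th term is the `k`-th step
  have step : ∀ k, k < K →
      rot60^[∑ i ∈ Finset.Icc 1 k, (turn α triPoint γ i).val] (γ 1 - γ 0) = γ (k + 1) - γ k := by
    intro k
    induction k with
    | zero => intro; simp
    | succ k ih =>
      intro hk
      rw [Finset.sum_Icc_succ_top (Nat.le_add_left 1 k), Nat.add_comm,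
        Function.iterate_add_apply, ih (Nat.lt_of_succ_lt hk)]
      have h := rot60_iterate_turn_triPoint hα hα' hγ (k := k + 1) k.succ_pos hk
      rwa [Nat.add_sub_cancel] at h
  have hsum : ∀ K', K' ≤ K → burgersVector α triPoint γ K' (γ 1 - γ 0) = γ K' - γ 0 := by
    intro K'
    induction K' with
    | zero => intro; simp
    | succ K' ih =>
      intro hK'
      rw [burgersVector_succ, ih (Nat.le_of_succ_le hK'), step K' hK']
      abel
  exact hsum K le_rfl

/-- Closed discrete paths in the perfect lattice have vanishing Burgers vector (direction = the
first step). [cite: Theil2006, §4.2 Remark 4.5 (preprint p. 20); sanity check] -/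
theorem burgersVector_triPoint_eq_zero (hα : 0 < α) (hα' : α ≤ 1 / 200) {γ : ℕ → ℤ × ℤ} {K : ℕ}
    (hγ : IsClosedPath α triPoint γ K) : burgersVector α triPoint γ K (γ 1 - γ 0) = 0 := by
  rw [burgersVector_triPoint hα hα' hγ.1, hγ.2, sub_self]

end Paths

end Theil2006

end Literature.MathematicalPhysics.StatisticalMechanics

end
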